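import HarnessLib
import Summits.HodgeConjecture.Statement
import Literature.AlgebraicGeometry.Motives.Varieties
import Literature.AlgebraicGeometry.Motives.Sweep1
import Literature.AlgebraicGeometry.Motives.HodgeTensor
import Literature.AlgebraicGeometry.Motives.HodgeTensorFactsHolds
import Literature.AlgebraicGeometry.Motives.FamiliesVHS
import Literature.AlgebraicGeometry.HodgeTheory.HodgeConjecture
import Literature.AlgebraicGeometry.HodgeTheory.BettiUniverseAxioms
import Literature.AlgebraicGeometry.HodgeTheory.ComplexConjugationHolds
import Literature.AlgebraicGeometry.HodgeTheory.LefschetzOneOne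
import Literature.AlgebraicGeometry.HodgeTheory.AlgebraicMonodromyMumfordTate
import Literature.AlgebraicGeometry.HodgeTheory.FibrewiseDeckRelations
import Literature.AlgebraicGeometry.HodgeTheory.QuaternionicQuarticCover
import Literature.AlgebraicGeometry.HodgeTheory.QuaternionicQuarticFamily
import Literature.AlgebraicGeometry.HodgeTheory.QuaternionicQuarticDeckChart
import Literature.AlgebraicGeometry.HodgeTheory.QuaternionicQuarticDeckChartAction
import Literature.Algebra.Lie.KatzRecognitionTheorems
import Literature.Algebra.Lie.KatzRecognitionAddenda
import Literature.AlgebraicGeometry.HodgeTheory.DeligneMonodromySemisimple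
import Literature.AlgebraicGeometry.Resolution.FunctorialResolutionAutomorphisms
import Summits.HodgeConjecture.HodgeConjecture.Theses.Q8SymplecticPowers
import Summits.HodgeConjecture.HodgeConjecture.Theorems.Q8BireflectionGroupDensityAmbientKatzFree
import Summits.HodgeConjecture.HodgeConjecture.Theorems.Q8SymplecticPowersMonodromyDeckCommutes
import Summits.HodgeConjecture.HodgeConjecture.Theorems.Q8SymplecticPowersCommKernel
import Summits.HodgeConjecture.HodgeConjecture.Theorems.Q8SymplecticPowersInvariantPartFiniteOrbit
import Summits.HodgeConjecture.HodgeConjecture.Theorems.Q8SymplecticPowersFiniteOrbitPartHodge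
import Summits.HodgeConjecture.HodgeConjecture.Theorems.Q8SymplecticPowersFiniteOrbitPartNondegenerate
import Summits.HodgeConjecture.HodgeConjecture.Theorems.Q8SymplecticPowersFibreBirational
import Summits.HodgeConjecture.HodgeConjecture.Theorems.Q8SymplecticPowersGenericityPolynomials
import Summits.HodgeConjecture.HodgeConjecture.Theorems.Q8SymplecticPowersStubTransportHeredityQ6
import Literature.AlgebraicGeometry.HodgeTheory.AlgebraicMonodromyMumfordTateOfQuasiProjective
import Literature.AlgebraicGeometry.HodgeTheory.MonodromySemisimpleSubvariations
import Literature.AlgebraicGeometry.HodgeTheory.DirectImageBaseChangeSections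
import Literature.AlgebraicGeometry.HodgeTheory.CyclicCoverReflectionMonodromy
import Literature.AlgebraicGeometry.HodgeTheory.BettiUniverseTracePairing
import Summits.HodgeConjecture.HodgeConjecture.Theorems.Q8SymplecticPowersDeckIsometry
import Literature.AlgebraicGeometry.HodgeTheory.QuaternionicQuarticPrimeSpecialisation
import Summits.HodgeConjecture.HodgeConjecture.Theorems.Q8SymplecticPowersK1QOfStubsKollarFree
import HarnessLib

/-!
# K1Q line `mechanism-v2` (skeleton v15): the crux is POINTWISE IN `e` — transport ∕ heredity per `e`, and the composition per `e`
# (so the `e = 4` case closes from `e = 4` inputs alone)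

Route `HodgeConjecture/Q8SymplecticPowers`, crux K1Q `VeryGeneralQuaternionCommutatorsInHg` (stmt-HodgeConjecture-24190). Helper
(`--supports stmt-HodgeConjecture-24190 --as helper`; nothing here closes an item; no definition; the line's two print inputs CDK 1995 and
Deligne 1987 Prop. 1.13 are hypotheses exactly as in `Q8SymplecticPowersStubTransportHeredityQ14` ∕ `Q8SymplecticPowersK1QOfStubsKollarFree`).

FINDING (kernel-checked). The registered composition of v15 proves the crux `∀ e` from stubs quantified `∀ e`; but every step is fibrewise
in `e`: the transport ∕ heredity theorem S7⁺⁺ (`stub_transportHeredityQ14`, p733298) destructures the `∃`-family AT the given `e` and never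
uses another `e`, and S1, LCERT enter at the same `e`. This file records that:

* `transportHeredity_at` — S7⁺⁺ with its `∀ e`-antecedent (the S9-shaped `∃`-family for every even `e ≥ 4`) replaced by the `∃`-family AT
  `e` (statement = the registered S7⁺⁺ signature with the quantifier moved; proof = the p733298 telescope VERBATIM with `hS9 he h4` replaced by
  the pointwise hypothesis). It implies S7⁺⁺.
* `K1Q_at_of_stubs_at` — for each even `e ≥ 4`: S1 AT `e` → the S9-`∃`-family AT `e` → CDK → Deligne87 → the crux body AT `e`.
* `K1Q_at_four_of_residues` — the `e = 4` case of the crux from `e = 4` inputs ONLY: S1 at `e = 4`, the registered LCERT₄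
  (`stub_memberLocalCertificateQ4`, verbatim), CDK, Deligne87. The stub LCERT_{≥6} — whose residue «uniform production in e» the skeleton's
  own docstring calls open — is NOT an input of the `e = 4` case.
* `K1Q_at_ge6_of_residues` — the even `e ≥ 6` cases from S1 at `e`, the registered LCERT_{≥6}, CDK, Deligne87.
* `VeryGeneralQuaternionCommutatorsInHg_of_pointwise` — re-assembly: the pointwise body for all even `e ≥ 4` IS the crux (by `exact`), so the
  per-`e` statements above are literally instances of the registered decl; `VeryGeneralQuaternionCommutatorsInHg_of_cases` re-runs the crux
  through the two cases.

Use for re-lining (planner's call, not made here): a sub-crux «K1Q at e = 4» has the line S1₄ (irregularity of ONE explicit double cover of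
`F₂`), LCERT₄, print CDK ∧ Deligne87 — three inputs fewer than v15 (no LCERT_{≥6}, no Kollár, no `e`-uniformity).

Honest scope: pure logic over landed theorems plus one verbatim re-run of the p733298 proof; S1, LCERT₄, LCERT_{≥6}, CDK, Deligne 1987, K1Q and
HC are NOT proved here.
-/

set_option linter.dupNamespace false
set_option maxHeartbeats 800000

namespace Summit.HodgeConjecture.HodgeConjecture.Theorems.Q8SymplecticPowersK1QPointwise

open Summit.HodgeConjecture.HodgeConjecture.Theses.Q8SymplecticPowers (VeryGeneralQuaternionCommutatorsInHg)
open CategoryTheory CategoryTheory.Limits AlgebraicGeometry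
open Literature.AlgebraicGeometry.Motives Literature.AlgebraicGeometry.HodgeTheory
open Literature.AlgebraicGeometry.HodgeTheory.BettiUniverse Literature.AlgebraicGeometry.HodgeTheory.Q8Family

/-- **Transport ∕ heredity, pointwise in `e`** (S7⁺⁺ `stub_transportHeredityQ14` with the `∃`-family taken AT `e` instead of for all `e`;
proof = the p733298 telescope verbatim: CDK cover of the non-Hodge-generic points, genericity polynomials (G7), DENSITY at a Hodge-generic
member via the Katz-free restriction currency, `Mon° ⊆ MT` (CMSP 15.3.7, tree theorem), the K1 kernel, fibre identification, S2).
[cite: CattaniDeligneKaplan1995, Thm. 1.1 and Cor. 1.2] [cite: Deligne1987, Prop. 1.13] [cite: CarlsonMullerStachPeters2017, Lemma–Def. 15.3.7] -/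
theorem transportHeredity_at :
    open Literature.AlgebraicGeometry.Motives Literature.AlgebraicGeometry.HodgeTheory Literature.AlgebraicGeometry.HodgeTheory.BettiUniverse Literature.AlgebraicGeometry.HodgeTheory.Q8Family Literature.AlgebraicGeometry.RelativeSpec Literature.AlgebraicGeometry.RelativeSpec.ActionOver Literature.Algebra.Lie Literature.Algebra.Lie.KatzRecognition CategoryTheory CategoryTheory.Limits MonoidalCategory CartesianMonoidalCategory AlgebraicGeometry in cmsp_nonHodgeGenericPoints_countable_algebraic_cover → Literature.AlgebraicGeometry.HodgeTheory.deligne1987_monodromy_directSum_irreducible_subvariations → (let Uni : (X : SchemeOver ℂ) → IsSmoothProjective 2 X → (X ⟶ X) → (X ⟶ X) → (bettiCohomology X 2 ≃ₗ[ℚ] bettiCohomology X 2) → Prop := fun X hX τ j g => (∀ x, g (pull τ 2 x) = pull τ 2 (g x)) ∧ (∀ x, g (pull j 2 x) = pull j 2 (g x)) ∧ (∀ x y, tr hX (2 + 2) (cup X 2 2 (g x) (g y)) = tr hX (2 + 2) (cup X 2 2 x y)) ∧ ∀ x ∈ (hodge exists_isReal_hodgeModel_holds hX 2).hodgeClasses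 1, g x = x; let Comm : (X : SchemeOver ℂ) → IsSmoothProjective 2 X → (X ⟶ X) → (X ⟶ X) → Prop := fun X hX τ j => haveI := finite hX 2; haveI : HodgeTensorFacts.{0, 0} := hodgeTensorFacts_holds; ∀ g h : bettiCohomology X 2 ≃ₗ[ℚ] bettiCohomology X 2, Uni X hX τ j g → Uni X hX τ j h → g * h * g⁻¹ * h⁻¹ ∈ (hodge exists_isReal_hodgeModel_holds hX 2).hodgeGroup; ∀ ⦃X X' : SchemeOver ℂ⦄ (hX : IsSmoothProjective 2 X) (hX' : IsSmoothProjective 2 X'), AlgebraicGeometry.Scheme.BirationalOver X.hom X'.hom → ∀ (τ j : X ⟶ X) (τ' j' : X' ⟶ X'), (pull τ 2 ^ 4 = 1 ∧ pull j 2 ^ 2 = pull τ 2 ^ 2 ∧ pull j 2 * pull τ 2 = pull τ 2 ^ 3 * pull j 2 ∧ Module.finrank ℂ ↥(Module.End.eigenspace ((pull τ 2 ^ 2).baseChange ℂ) 1 ⊓ (hodge exists_isReal_hodgeModel_holds hX 2).piece 2 0) = 0 ∧ 0 < Module.finrank ℂ ↥(Module.End.eigenspace ((pull τ 2 ^ 2).baseChange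 ℂ) (-1) ⊓ (hodge exists_isReal_hodgeModel_holds hX 2).piece 2 0)) → (pull τ' 2 ^ 4 = 1 ∧ pull j' 2 ^ 2 = pull τ' 2 ^ 2 ∧ pull j' 2 * pull τ' 2 = pull τ' 2 ^ 3 * pull j' 2 ∧ Module.finrank ℂ ↥(Module.End.eigenspace ((pull τ' 2 ^ 2).baseChange ℂ) 1 ⊓ (hodge exists_isReal_hodgeModel_holds hX' 2).piece 2 0) = 0 ∧ 0 < Module.finrank ℂ ↥(Module.End.eigenspace ((pull τ' 2 ^ 2).baseChange ℂ) (-1) ⊓ (hodge exists_isReal_hodgeModel_holds hX' 2).piece 2 0)) → Comm X hX τ j → Comm X' hX' τ' j') → let Uni : (X : SchemeOver ℂ) → IsSmoothProjective 2 X → (X ⟶ X) → (X ⟶ X) → (bettiCohomology X 2 ≃ₗ[ℚ] bettiCohomology X 2) → Prop := fun X hX τ j g => (∀ x, g (pull τ 2 x) = pull τ 2 (g x)) ∧ (∀ x, g (pull j 2 x) = pull j 2 (g x)) ∧ (∀ x y, tr hX (2 + 2) (cup X 2 2 (g x) (g y)) = tr hX (2 + 2) (cup X 2 2 x y)) ∧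 ∀ x ∈ (hodge exists_isReal_hodgeModel_holds hX 2).hodgeClasses 1, g x = x; let Comm : (X : SchemeOver ℂ) → IsSmoothProjective 2 X → (X ⟶ X) → (X ⟶ X) → Prop := fun X hX τ j => haveI := finite hX 2; haveI : HodgeTensorFacts.{0, 0} := hodgeTensorFacts_holds; ∀ g h : bettiCohomology X 2 ≃ₗ[ℚ] bettiCohomology X 2, Uni X hX τ j g → Uni X hX τ j h → g * h * g⁻¹ * h⁻¹ ∈ (hodge exists_isReal_hodgeModel_holds hX 2).hodgeGroup; ∀ ⦃e : ℕ⦄, Even e → 4 ≤ e → (∃ (W : (Spec (.of (ParamRing e))).Opens) (𝒳 : SchemeOver ℂ) (π : 𝒳 ⟶ base W) (τ j : 𝒳 ⟶ 𝒳) (ι : (deckChart (fun i => (MvPolynomial.X i : ParamRing e)) ⊗ Over.mk W.ι).left ⟶ 𝒳.left), ∃ (_ : Nonempty (ComplexPoints (base W))) (hπ : IsSmoothProjectiveFamily π 2) (_ : IsQuasiProjectiveOver 𝒳) (_ : IsQuasiProjectiveOver (base W)) (_ : AlgebraicGeometry.SmoothOfRelativeDimension (Fintype.card (CIdx e)) (base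 W).hom) (hτπ : τ ≫ π = π) (hjπ : j ≫ π = π) (_ : τ ≫ τ ≫ τ ≫ τ = 𝟙 𝒳) (_ : j ≫ j = τ ≫ τ) (_ : τ ≫ j ≫ τ = j) (_ : IsOpenImmersion ι) (_ : ι ≫ π.left = (snd (deckChart (fun i => (MvPolynomial.X i : ParamRing e))) (Over.mk W.ι)).left) (_ : ((Over.isoMk ((deckAction (fun i => (MvPolynomial.X i : ParamRing e))).aut (QuaternionGroup.a 1)) ((deckAction (fun i => (MvPolynomial.X i : ParamRing e))).aut_comp (QuaternionGroup.a 1))).hom ▷ Over.mk W.ι).left ≫ ι = ι ≫ τ.left) (_ : ((Over.isoMk ((deckAction (fun i => (MvPolynomial.X i : ParamRing e))).aut (QuaternionGroup.xa 0)) ((deckAction (fun i => (MvPolynomial.X i : ParamRing e))).aut_comp (QuaternionGroup.xa 0))).hom ▷ Over.mk W.ι).left ≫ ι = ι ≫ j.left) (_ : Function.Surjective (snd (deckChart (fun i => (MvPolynomial.X i : ParamRing e))) (Over.mk W.ι)).left), ∀ (hU : IsCohomologicallyLocallyTrivialOn π Set.univ), (∀ s : ComplexPoints (base W), let Xs :=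 fiberOver π s; let hXs : IsSmoothProjective 2 Xs := hπ.isSmoothProjective s; let A : bettiCohomology Xs 2 →ₗ[ℚ] bettiCohomology Xs 2 := pull (fiberOverEnd π τ hτπ s) 2; let Qf : LinearMap.BilinForm ℚ (bettiCohomology Xs 2) := LinearMap.compr₂ (cup Xs 2 2) (tr hXs (2 + 2)); let Γ := ratMonodromyGroup π 2 hU ⟨s, Set.mem_univ s⟩; let N : Submodule ℚ (bettiCohomology Xs 2) := Submodule.span ℚ {x | ∃ Γ' : Subgroup (bettiCohomology Xs 2 ≃ₗ[ℚ] bettiCohomology Xs 2), Γ' ≤ Γ ∧ (Γ'.subgroupOf Γ).FiniteIndex ∧ ∀ γ ∈ Γ', γ x = x}; let Mv : Submodule ℚ (bettiCohomology Xs 2) := Module.End.eigenspace (A ^ 2) (-1) ⊓ Qf.orthogonal N; let Miv : Submodule ℂ (TensorProduct ℚ ℂ (bettiCohomology Xs 2)) := Mv.baseChange ℂ ⊓ Module.End.eigenspace (A.baseChange ℂ) Complex.I; Module.finrank ℂ ↥(Module.End.eigenspace ((A ^ 2).baseChange ℂ) 1 ⊓ (hodge exists_isReal_hodgeModel_holds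 hXs 2).piece 2 0) = 0 ∧ 0 < Module.finrank ℂ ↥(Module.End.eigenspace ((A ^ 2).baseChange ℂ) (-1) ⊓ (hodge exists_isReal_hodgeModel_holds hXs 2).piece 2 0) ∧ (N.baseChange ℂ ⊓ (hodge exists_isReal_hodgeModel_holds hXs 2).piece 2 0 = ⊥) ∧ 6 ≤ Module.finrank ℂ Miv ∧ (∀ Γ' : Subgroup (bettiCohomology Xs 2 ≃ₗ[ℚ] bettiCohomology Xs 2), Γ' ≤ Γ → (Γ'.subgroupOf Γ).FiniteIndex → ∀ F : Submodule ℂ (TensorProduct ℚ ℂ (bettiCohomology Xs 2)), F ≤ Miv → (∀ γ ∈ Γ', ∀ x ∈ F, (γ.toLinearMap.baseChange ℂ) x ∈ F) → F = ⊥ ∨ F = Miv) ∧ N ≤ Module.End.eigenspace (A ^ 2) 1) ∧ (∀ s : ComplexPoints (base W), let Xs := fiberOver π s; let hXs : IsSmoothProjective 2 Xs := hπ.isSmoothProjective s; let A : bettiCohomology Xs 2 →ₗ[ℚ] bettiCohomology Xs 2 := pull (fiberOverEnd π τ hτπ s) 2; let B : bettiCohomology Xs 2 →ₗ[ℚ]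 bettiCohomology Xs 2 := pull (fiberOverEnd π j hjπ s) 2; let Qf : LinearMap.BilinForm ℚ (bettiCohomology Xs 2) := LinearMap.compr₂ (cup Xs 2 2) (tr hXs (2 + 2)); let Γ := ratMonodromyGroup π 2 hU ⟨s, Set.mem_univ s⟩; ∃ γ ∈ Γ, ∃ ℓp ℓm : TensorProduct ℚ ℂ (bettiCohomology Xs 2), ℓp ∈ (Module.End.eigenspace (A ^ 2) (-1)).baseChange ℂ ∧ ℓm ∈ (Module.End.eigenspace (A ^ 2) (-1)).baseChange ℂ ∧ A.baseChange ℂ ℓp = Complex.I • ℓp ∧ A.baseChange ℂ ℓm = Complex.I • ℓm ∧ (Qf.baseChange ℂ) ℓp (B.baseChange ℂ ℓm) ≠ 0 ∧ (γ.toLinearMap.baseChange ℂ) ℓp = Complex.I • ℓp ∧ (γ.toLinearMap.baseChange ℂ) ℓm = (-Complex.I) • ℓm ∧ ∀ x ∈ (Module.End.eigenspace (A ^ 2) (-1)).baseChange ℂ, A.baseChange ℂ x = Complex.I • x → (Qf.baseChange ℂ) x (B.baseChange ℂ ℓp) = 0 → (Qf.baseChange ℂ) x (B.baseChange ℂ ℓm)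 = 0 → (γ.toLinearMap.baseChange ℂ) x = x)) → ∃ G : ℕ → MvPolynomial ({d : Fin 3 →₀ ℕ // d.degree = 1} ⊕ {d : Fin 3 →₀ ℕ // d.degree = e - 1}) ℂ, (∀ i, ∃ c ψ : MvPolynomial (Fin 3) ℂ, c.IsHomogeneous 1 ∧ ψ.IsHomogeneous (e - 1) ∧ MvPolynomial.rename (Equiv.swap (0 : Fin 3) 1) ψ = ψ ∧ MvPolynomial.eval (Sum.elim (fun d => c.coeff d.1) (fun d => ψ.coeff d.1)) (G i) ≠ 0) ∧ ∀ c ψ : MvPolynomial (Fin 3) ℂ, c.IsHomogeneous 1 → ψ.IsHomogeneous (e - 1) → MvPolynomial.rename (Equiv.swap (0 : Fin 3) 1) ψ = ψ → (∀ i, MvPolynomial.eval (Sum.elim (fun d => c.coeff d.1) (fun d => ψ.coeff d.1)) (G i) ≠ 0) → ∀ ⦃V X : SchemeOver ℂ⦄ (hX : IsSmoothProjective 2 X), IsHypersurfaceCutOutBy 3 (MvPolynomial.X (Fin.last 3) ^ 4 * MvPolynomial.X (Fin.castSucc 2) ^ (2 * e) - MvPolynomial.rename Fin.castSucc (c * MvPolynomial.rename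 (Equiv.swap (0 : Fin 3) 1) c ^ 3 * ((MvPolynomial.X 0 - MvPolynomial.X 1) * ψ) ^ 2)) V → AlgebraicGeometry.Scheme.BirationalOver X.hom V.hom → ∀ τ j : X ⟶ X, (pull τ 2 ^ 4 = 1 ∧ pull j 2 ^ 2 = pull τ 2 ^ 2 ∧ pull j 2 * pull τ 2 = pull τ 2 ^ 3 * pull j 2 ∧ Module.finrank ℂ ↥(Module.End.eigenspace ((pull τ 2 ^ 2).baseChange ℂ) 1 ⊓ (hodge exists_isReal_hodgeModel_holds hX 2).piece 2 0) = 0 ∧ 0 < Module.finrank ℂ ↥(Module.End.eigenspace ((pull τ 2 ^ 2).baseChange ℂ) (-1) ⊓ (hodge exists_isReal_hodgeModel_holds hX 2).piece 2 0)) → Comm X hX τ j := by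
  intro hCDK hDelB hS2 Uni Comm e he h4 hS9
  obtain ⟨W, 𝒳, π, τ, j, ι, hne, hπ, hqp, hqpW, hsm, hτπ, hjπ, hτ4, hj2, hτjτ, hιo, hιπ, hιτ, hιj, hsurj, h45⟩ :=
    hS9
  -- ### base facts of the family
  haveI := hsm
  haveI : AlgebraicGeometry.Smooth (base W).hom :=
    AlgebraicGeometry.SmoothOfRelativeDimension.smooth (Fintype.card (CIdx e)) (base W).hom
  have hU : IsCohomologicallyLocallyTrivialOn π (Set.univ : Set (ComplexPoints (base W))) :=
    isCohomologicallyLocallyTrivialOn_univ_of_isSmoothProjectiveFamily_of_smooth π hπ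
  obtain ⟨h4all, h5all⟩ := h45 hU
  haveI : HodgeTensorFacts.{0, 0} := hodgeTensorFacts_holds
  haveI hfin : ∀ t : ComplexPoints (base W), Module.Finite ℚ (bettiCohomology (fiberOver π t) 2) :=
    fun t => finite (hπ.isSmoothProjective t) 2
  -- the real Hodge models of the fibres (so that `(Am t).hodgeStructure … 2 = hodge … 2` definitionally)
  let Am : ∀ t : ComplexPoints (base W), HodgeModel 2 (fiberOver π t) := fun t =>
    realHodgeModel exists_isReal_hodgeModel_holds (hπ.isSmoothProjective t)
  have hAm : ∀ t, (Am t).IsHodgeSymmetric := fun t =>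
    realHodgeModel_isHodgeSymmetric exists_isReal_hodgeModel_holds (hπ.isSmoothProjective t)
  have hirr : IrreducibleSpace (base W).left := by
    obtain ⟨t₀⟩ := hne
    haveI : IrreducibleSpace (Spec (CommRingCat.of (ParamRing e))) :=
      inferInstanceAs (IrreducibleSpace (PrimeSpectrum (ParamRing e)))
    change IrreducibleSpace W
    exact isIrreducible_iff_irreducibleSpace.mp ⟨⟨W.ι t₀.pt, by rw [← Scheme.Opens.range_ι]; exact ⟨t₀.pt, rfl⟩⟩,
      (PreirreducibleSpace.isPreirreducible_univ (X := Spec (CommRingCat.of (ParamRing e)))).open_subset W.isOpen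
        (Set.subset_univ _)⟩
  -- ### the Cattani–Deligne–Kaplan cover of the non-Hodge-generic points
  obtain ⟨Wbad, hWbad, hgen⟩ := hCDK π 2 2 hπ hqpW inferInstance hirr hU Am hAm
  -- ### the genericity polynomials (G7): complement of `W`, the CDK cover, the chart genericity element
  have hG : ∃ G : ℕ → MvPolynomial ({d : Fin 3 →₀ ℕ // d.degree = 1} ⊕ {d : Fin 3 →₀ ℕ // d.degree = e - 1}) ℂ,
      (∀ i, ∃ c ψ : MvPolynomial (Fin 3) ℂ, c.IsHomogeneous 1 ∧ ψ.IsHomogeneous (e - 1) ∧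
        MvPolynomial.rename (Equiv.swap (0 : Fin 3) 1) ψ = ψ ∧
        MvPolynomial.eval (Sum.elim (fun d => c.coeff d.1) (fun d => ψ.coeff d.1)) (G i) ≠ 0) ∧
      ∀ c ψ : MvPolynomial (Fin 3) ℂ, c.IsHomogeneous 1 → ψ.IsHomogeneous (e - 1) →
        MvPolynomial.rename (Equiv.swap (0 : Fin 3) 1) ψ = ψ →
        (∀ i, MvPolynomial.eval (Sum.elim (fun d => c.coeff d.1) (fun d => ψ.coeff d.1)) (G i) ≠ 0) →
        ∃ t : ComplexPoints (base W), cOf (coeffs W t) = c ∧ ψOf (coeffs W t) = ψ ∧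
          IsHodgeGenericPoint π 2 hU hπ Am hAm ⟨t, Set.mem_univ t⟩ ∧
          MvPolynomial.eval (coeffs W t) (genericityElem e) ≠ 0 := by
    -- G7: the coset device
    obtain ⟨G, hGne, hGpt⟩ := Q8SymplecticPowersGenericityPolynomials.exists_genericityPolynomials W hne Wbad hWbad
      (genericityElem e) (genericityElem_ne_zero e (by omega))
    refine ⟨G, hGne, fun c ψ hc hψ hψσ hGi => ?_⟩
    obtain ⟨t, htc, htψ, htbad, htG⟩ := hGpt c ψ hc hψ hψσ hGi
    refine ⟨t, htc, htψ, ?_, htG⟩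
    by_contra hng
    obtain ⟨j, hj⟩ := hgen ⟨t, Set.mem_univ t⟩ hng
    exact htbad j hj
  obtain ⟨G, hGne, hGpt⟩ := hG
  refine ⟨G, hGne, ?_⟩
  intro c ψ hc hψ hψσ hGi V X hX hV hbir τ' j' hb'
  obtain ⟨t, htc, htψ, hgen_t, hGe⟩ := hGpt c ψ hc hψ hψσ hGi
  -- ### the registered point data at `t`
  have h4t := h4all t
  have h5t6 := h5all t
  -- the S5 body at `t` in the `Mv`-currency of the restriction theorem (v6 → v5 glue: `Mv = ker(A²+1)` from (iv) + isometry)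
  have h5t : let Xs := fiberOver π t; let hXs : IsSmoothProjective 2 Xs := hπ.isSmoothProjective t; let A : bettiCohomology Xs 2 →ₗ[ℚ] bettiCohomology Xs 2 := pull (fiberOverEnd π τ hτπ t) 2; let B : bettiCohomology Xs 2 →ₗ[ℚ] bettiCohomology Xs 2 := pull (fiberOverEnd π j hjπ t) 2; let Qf : LinearMap.BilinForm ℚ (bettiCohomology Xs 2) := LinearMap.compr₂ (cup Xs 2 2) (tr hXs (2 + 2)); let Γ := ratMonodromyGroup π 2 hU ⟨t, Set.mem_univ t⟩; let N : Submodule ℚ (bettiCohomology Xs 2) := Submodule.span ℚ {x | ∃ Γ' : Subgroup (bettiCohomology Xs 2 ≃ₗ[ℚ] bettiCohomology Xs 2), Γ' ≤ Γ ∧ (Γ'.subgroupOf Γ).FiniteIndex ∧ ∀ γ ∈ Γ', γ x = x}; let Mv : Submodule ℚ (bettiCohomology Xs 2) := Module.End.eigenspace (A ^ 2) (-1) ⊓ Qf.orthogonal N; ∃ γ ∈ Γ, ∃ ℓp ℓm : TensorProduct ℚ ℂ (bettiCohomology Xs 2), ℓp ∈ Mv.baseChange ℂ ∧ ℓm ∈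 Mv.baseChange ℂ ∧ A.baseChange ℂ ℓp = Complex.I • ℓp ∧ A.baseChange ℂ ℓm = Complex.I • ℓm ∧ (Qf.baseChange ℂ) ℓp (B.baseChange ℂ ℓm) ≠ 0 ∧ (γ.toLinearMap.baseChange ℂ) ℓp = Complex.I • ℓp ∧ (γ.toLinearMap.baseChange ℂ) ℓm = (-Complex.I) • ℓm ∧ ∀ x ∈ Mv.baseChange ℂ, A.baseChange ℂ x = Complex.I • x → (Qf.baseChange ℂ) x (B.baseChange ℂ ℓp) = 0 → (Qf.baseChange ℂ) x (B.baseChange ℂ ℓm) = 0 → (γ.toLinearMap.baseChange ℂ) x = x := by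
    intro Xs hXs A B Qf Γ N Mv
    obtain ⟨-, ho', -, -, -, hiv⟩ := h4t
    have hpg : (hodge exists_isReal_hodgeModel_holds (hπ.isSmoothProjective t) 2).piece 2 0 ≠ ⊥ := by
      intro h0
      rw [h0, inf_bot_eq, finrank_bot] at ho'
      exact lt_irrefl 0 ho'
    obtain ⟨r1, -, -⟩ := quaternionRelations_pull_fiberOverEnd π hτπ hjπ hτ4 hj2 hτjτ t 2
    have hAQ := Q8SymplecticPowersDeckIsometry.tr_cup_pull_pull_of_pull_pow_eq_one (hπ.isSmoothProjective t)
      (fiberOverEnd π τ hτπ t) (by norm_num : 0 < 4) r1 hpg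
    have hMv : Mv = Module.End.eigenspace (A ^ 2) (-1) :=
      Q8SymplecticPowersStubTransportHeredityQ6.eigenspace_sq_neg_one_inf_orthogonal_eq A Qf
        (fun x y => (LinearMap.compr₂_apply _ _ _ _).trans ((hAQ x y).trans (LinearMap.compr₂_apply _ _ _ _).symm)) N hiv
    rw [hMv]
    exact h5t6
  have hXt : IsSmoothProjective 2 (fiberOver π t) := hπ.isSmoothProjective t
  -- ### DENSITY at `t` (restriction currency + G1–G5)
  have hDens : ∀ g : bettiCohomology (fiberOver π t) 2 ≃ₗ[ℚ] bettiCohomology (fiberOver π t) 2,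
      Uni (fiberOver π t) hXt (fiberOverEnd π τ hτπ t) (fiberOverEnd π j hjπ t) g →
        g ∈ glIdentityComponent (ratMonodromyGroup π 2 hU ⟨t, Set.mem_univ t⟩) := by
    intro g hg
    obtain ⟨hgA, hgB, hgQ, hgH⟩ := hg
    obtain ⟨ho, ho', hi, hii, hiii, -⟩ := h4t
    obtain ⟨r1, r2, r3⟩ := quaternionRelations_pull_fiberOverEnd π hτπ hjπ hτ4 hj2 hτjτ t 2
    -- `p_g(X_t) > 0` from (o′)
    have hpg : (hodge exists_isReal_hodgeModel_holds hXt 2).piece 2 0 ≠ ⊥ := by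
      intro h0
      rw [h0, inf_bot_eq, finrank_bot] at ho'
      exact lt_irrefl 0 ho'
    -- the deck maps are isometries of `Qf`
    have hj4 : pull (fiberOverEnd π j hjπ t) 2 ^ 4 = 1 := by
      rw [show (4 : ℕ) = 2 * 2 from rfl, pow_mul, r2, ← pow_mul]; exact r1
    have hAQ := Q8SymplecticPowersDeckIsometry.tr_cup_pull_pull_of_pull_pow_eq_one hXt (fiberOverEnd π τ hτπ t)
      (by norm_num : 0 < 4) r1 hpg
    have hBQ := Q8SymplecticPowersDeckIsometry.tr_cup_pull_pull_of_pull_pow_eq_one hXt (fiberOverEnd π j hjπ t)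
      (by norm_num : 0 < 4) hj4 hpg
    -- G3: the finite-orbit part consists of Hodge classes (fixed part on the finite étale cover, FACT B, + S4 (i))
    have hNsub : ∀ x ∈ Submodule.span ℚ {x : bettiCohomology (fiberOver π t) 2 |
        ∃ Γ' : Subgroup (bettiCohomology (fiberOver π t) 2 ≃ₗ[ℚ] bettiCohomology (fiberOver π t) 2),
          Γ' ≤ ratMonodromyGroup π 2 hU ⟨t, Set.mem_univ t⟩ ∧
          (Γ'.subgroupOf (ratMonodromyGroup π 2 hU ⟨t, Set.mem_univ t⟩)).FiniteIndex ∧ ∀ γ ∈ Γ', γ x = x},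
        x ∈ (hodge exists_isReal_hodgeModel_holds hXt 2).hodgeClasses 1 := fun x hx =>
      Q8SymplecticPowersFiniteOrbitPartHodge.span_finiteIndexFixed_le_hodgeClasses_one π hπ hqpW (Fintype.card (CIdx e)) hU t hDelB
        hi hx
    -- G4: FIN₊ — the `τ²`-invariant part has finite monodromy (S4 (o) + Deligne 1982 move (F))
    have hV : Module.End.eigenspace (pull (fiberOverEnd π τ hτπ t) 2 ^ 2) 1 ≤
        Submodule.span ℚ {x : bettiCohomology (fiberOver π t) 2 |
          ∃ Γ' : Subgroup (bettiCohomology (fiberOver π t) 2 ≃ₗ[ℚ] bettiCohomology (fiberOver π t) 2),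
            Γ' ≤ ratMonodromyGroup π 2 hU ⟨t, Set.mem_univ t⟩ ∧
            (Γ'.subgroupOf (ratMonodromyGroup π 2 hU ⟨t, Set.mem_univ t⟩)).FiniteIndex ∧ ∀ γ ∈ Γ', γ x = x} :=
      Q8SymplecticPowersInvariantPartFiniteOrbit.eigenspace_sq_le_span_finiteIndexFixed π hπ hqp hqpW (Fintype.card (CIdx e)) hU τ hτπ t
        (fun γ hγ x => Q8SymplecticPowersMonodromyDeckCommutes.apply_pull_fiberOverEnd_of_mem_ratMonodromyGroup π 2 hU τ hτπ t hγ x) ho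
    -- G5: `Qf|_N` is non-degenerate (Hodge–Riemann on the rational (1,1)-classes + the flat hyperplane class)
    have hNQ : ∀ x ∈ Submodule.span ℚ {x : bettiCohomology (fiberOver π t) 2 |
        ∃ Γ' : Subgroup (bettiCohomology (fiberOver π t) 2 ≃ₗ[ℚ] bettiCohomology (fiberOver π t) 2),
          Γ' ≤ ratMonodromyGroup π 2 hU ⟨t, Set.mem_univ t⟩ ∧
          (Γ'.subgroupOf (ratMonodromyGroup π 2 hU ⟨t, Set.mem_univ t⟩)).FiniteIndex ∧ ∀ γ ∈ Γ', γ x = x},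
        (∀ y ∈ Submodule.span ℚ {x : bettiCohomology (fiberOver π t) 2 |
          ∃ Γ' : Subgroup (bettiCohomology (fiberOver π t) 2 ≃ₗ[ℚ] bettiCohomology (fiberOver π t) 2),
            Γ' ≤ ratMonodromyGroup π 2 hU ⟨t, Set.mem_univ t⟩ ∧
            (Γ'.subgroupOf (ratMonodromyGroup π 2 hU ⟨t, Set.mem_univ t⟩)).FiniteIndex ∧ ∀ γ ∈ Γ', γ x = x},
          LinearMap.compr₂ (cup (fiberOver π t) 2 2) (tr hXt (2 + 2)) x y = 0) → x = 0 :=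
      Q8SymplecticPowersFiniteOrbitPartNondegenerate.tr_cup_nondegenerate_on_span_finiteIndexFixed π hπ hqp hqpW hU t hNsub
    exact Q8BireflectionGroupDensityAmbientKatzFree.mem_glIdentityComponent_of_variablePart
      (Qf := LinearMap.compr₂ (cup (fiberOver π t) 2 2) (tr hXt (2 + 2)))
      (fun x y => by simp only [LinearMap.compr₂_apply]; rw [BettiUniverse.cup_comm_of_even (by decide)])
      (nondegenerate_tr_cup hXt) r1 r2 r3
      (fun x y => by simpa only [LinearMap.compr₂_apply] using hAQ x y)
      (fun x y => by simpa only [LinearMap.compr₂_apply] using hBQ x y)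
      (Γ := ratMonodromyGroup π 2 hU ⟨t, Set.mem_univ t⟩)
      (fun γ hγ x => Q8SymplecticPowersMonodromyDeckCommutes.apply_pull_fiberOverEnd_of_mem_ratMonodromyGroup π 2 hU τ hτπ t hγ x)
      (fun γ hγ x => Q8SymplecticPowersMonodromyDeckCommutes.apply_pull_fiberOverEnd_of_mem_ratMonodromyGroup π 2 hU j hjπ t hγ x)
      (fun γ hγ x y => by
        simpa only [LinearMap.compr₂_apply] using
          Q8SymplecticPowersMonodromyDeckCommutes.tr_cup_apply_apply_of_mem_ratMonodromyGroup π hπ hqp hqpW hU t hγ x y)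
      rfl hV hNQ rfl hii hiii h5t hgA hgB (fun x y => by simpa only [LinearMap.compr₂_apply] using hgQ x y)
      (fun x hx => hgH x (hNsub x hx))
  -- ### `Mon ⊆ MT` at the Hodge-generic point `t` (Deligne 1972 ∕ CMSP 15.3.7, tree theorem) and the K1 kernel ⇒ `Comm` at `t`
  have hMT : glIdentityComponent (ratMonodromyGroup π 2 hU ⟨t, Set.mem_univ t⟩) ⊆
      (((Am t).hodgeStructure hXt (hAm t) 2).mumfordTateGroup :
        Set (bettiCohomology (fiberOver π t) 2 ≃ₗ[ℚ] bettiCohomology (fiberOver π t) 2)) :=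
    (deligne_finiteIndex_monodromy_le_mumfordTateGroup_of_isQuasiProjectiveOver π 2 2 hπ hqp hqpW inferInstance hirr hU
      Am hAm ⟨t, Set.mem_univ t⟩ hgen_t).2
  have hCommt : Comm (fiberOver π t) hXt (fiberOverEnd π τ hτπ t) (fiberOverEnd π j hjπ t) := by
    refine Q8SymplecticPowersCommKernel.q8Comm_of_glIdentityComponent_subset_mumfordTateGroup π hU
      (fun s => hπ.isSmoothProjective s) Am hAm t hXt (Iso.refl _) _ _ hMT fun g hg => ?_
    have hid : (pullEquiv (Iso.refl (fiberOver π t)) 2).trans (g.trans (pullEquiv (Iso.refl (fiberOver π t)) 2).symm) = g := by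
      ext v
      simp only [LinearEquiv.trans_apply, pullEquiv_apply, pullEquiv_symm_apply, Iso.refl_inv, Iso.refl_hom, pull_id,
        LinearMap.id_apply]
    rw [hid]
    exact hDens g hg
  -- ### the deck-pair binders at `t` (relations: `quaternionRelations_pull_fiberOverEnd`; Hodge numbers: S4 (o)(o′))
  have hbind_t : pull (fiberOverEnd π τ hτπ t) 2 ^ 4 = 1 ∧
      pull (fiberOverEnd π j hjπ t) 2 ^ 2 = pull (fiberOverEnd π τ hτπ t) 2 ^ 2 ∧
      pull (fiberOverEnd π j hjπ t) 2 * pull (fiberOverEnd π τ hτπ t) 2 =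
        pull (fiberOverEnd π τ hτπ t) 2 ^ 3 * pull (fiberOverEnd π j hjπ t) 2 ∧
      Module.finrank ℂ ↥(Module.End.eigenspace ((pull (fiberOverEnd π τ hτπ t) 2 ^ 2).baseChange ℂ) 1 ⊓
        (hodge exists_isReal_hodgeModel_holds hXt 2).piece 2 0) = 0 ∧
      0 < Module.finrank ℂ ↥(Module.End.eigenspace ((pull (fiberOverEnd π τ hτπ t) 2 ^ 2).baseChange ℂ) (-1) ⊓
        (hodge exists_isReal_hodgeModel_holds hXt 2).piece 2 0) := by
    obtain ⟨r1, r2, r3⟩ := quaternionRelations_pull_fiberOverEnd π hτπ hjπ hτ4 hj2 hτjτ t 2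
    obtain ⟨ho, ho', -⟩ := h4t
    exact ⟨r1, r2, r3, ho, ho'⟩
  -- ### fibre identification (chart surjectivity + CHART-IN-COVER birationality) and S2
  have hbir_t : AlgebraicGeometry.Scheme.BirationalOver (fiberOver π t).hom X.hom := by
    have he1 : 1 ≤ e := by omega
    have hbV := Q8SymplecticPowersFibreBirational.birationalOver_fiberOver_of_deckClauses he1 W 𝒳 π ι hπ hιo hιπ hsurj t hGe
      (V := V) (by rw [htc, htψ]; exact hV)
    exact hbV.trans hbir.symm
  exact hS2 hXt hX hbir_t (fiberOverEnd π τ hτπ t) (fiberOverEnd π j hjπ t) τ' j' hbind_t hb' hCommt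


/-- **The crux body AT `e` from the stubs AT `e`**: S1 at `e`, the S9-shaped `∃`-family at `e`, and the print inputs CDK, Deligne 1987
(S2 by name, `Q8SymplecticPowersAutFreeReduction.stub_autFreeReductionQ`; the two families of genericity polynomials are interleaved as in
the v15 composition). [cite: CattaniDeligneKaplan1995, Thm. 1.1 and Cor. 1.2] [cite: Deligne1987, Prop. 1.13] -/
theorem K1Q_at_of_stubs_at
    (hcdk : open Literature.AlgebraicGeometry.HodgeTheory in cmsp_nonHodgeGenericPoints_countable_algebraic_cover)
    (hdel : Literature.AlgebraicGeometry.HodgeTheory.deligne1987_monodromy_directSum_irreducible_subvariations) :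
    open Literature.AlgebraicGeometry.Motives Literature.AlgebraicGeometry.HodgeTheory Literature.AlgebraicGeometry.HodgeTheory.BettiUniverse Literature.AlgebraicGeometry.HodgeTheory.Q8Family Literature.AlgebraicGeometry.RelativeSpec Literature.AlgebraicGeometry.RelativeSpec.ActionOver Literature.Algebra.Lie Literature.Algebra.Lie.KatzRecognition CategoryTheory CategoryTheory.Limits MonoidalCategory CartesianMonoidalCategory AlgebraicGeometry in let Uni : (X : SchemeOver ℂ) → IsSmoothProjective 2 X → (X ⟶ X) → (X ⟶ X) → (bettiCohomology X 2 ≃ₗ[ℚ] bettiCohomology X 2) → Prop := fun X hX τ j g => (∀ x, g (pull τ 2 x) = pull τ 2 (g x)) ∧ (∀ x, g (pull j 2 x) = pull j 2 (g x)) ∧ (∀ x y, tr hX (2 + 2) (cup X 2 2 (g x) (g y)) = tr hX (2 + 2) (cup X 2 2 x y)) ∧ ∀ x ∈ (hodge exists_isReal_hodgeModel_holds hX 2).hodgeClasses 1, g x = x; let Comm : (X : SchemeOver ℂ) → IsSmoothProjective 2 X → (X ⟶ X) → (X ⟶ X) → Prop := fun X hX τ j => haveI := finite hX 2; haveI : HodgeTensorFacts.{0,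 0} := hodgeTensorFacts_holds; ∀ g h : bettiCohomology X 2 ≃ₗ[ℚ] bettiCohomology X 2, Uni X hX τ j g → Uni X hX τ j h → g * h * g⁻¹ * h⁻¹ ∈ (hodge exists_isReal_hodgeModel_holds hX 2).hodgeGroup; ∀ ⦃e : ℕ⦄, Even e → 4 ≤ e → (∃ G : ℕ → MvPolynomial ({d : Fin 3 →₀ ℕ // d.degree = 1} ⊕ {d : Fin 3 →₀ ℕ // d.degree = e - 1}) ℂ, (∀ i, ∃ c ψ : MvPolynomial (Fin 3) ℂ, c.IsHomogeneous 1 ∧ ψ.IsHomogeneous (e - 1) ∧ MvPolynomial.rename (Equiv.swap (0 : Fin 3) 1) ψ = ψ ∧ MvPolynomial.eval (Sum.elim (fun d => c.coeff d.1) (fun d => ψ.coeff d.1)) (G i) ≠ 0) ∧ ∀ c ψ : MvPolynomial (Fin 3) ℂ, c.IsHomogeneous 1 → ψ.IsHomogeneous (e - 1) → MvPolynomial.rename (Equiv.swap (0 : Fin 3) 1) ψ = ψ → (∀ i, MvPolynomial.eval (Sum.elim (fun d => c.coeff d.1) (fun d => ψ.coeff d.1)) (G i) ≠ 0) → ∀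 ⦃V X : SchemeOver ℂ⦄ (hX : IsSmoothProjective 2 X), IsHypersurfaceCutOutBy 3 (MvPolynomial.X (Fin.last 3) ^ 4 * MvPolynomial.X (Fin.castSucc 2) ^ (2 * e) - MvPolynomial.rename Fin.castSucc (c * MvPolynomial.rename (Equiv.swap (0 : Fin 3) 1) c ^ 3 * ((MvPolynomial.X 0 - MvPolynomial.X 1) * ψ) ^ 2)) V → AlgebraicGeometry.Scheme.BirationalOver X.hom V.hom → Module.finrank ℚ (bettiCohomology X 1) = 0) → (∃ (W : (Spec (.of (ParamRing e))).Opens) (𝒳 : SchemeOver ℂ) (π : 𝒳 ⟶ base W) (τ j : 𝒳 ⟶ 𝒳) (ι : (deckChart (fun i => (MvPolynomial.X i : ParamRing e)) ⊗ Over.mk W.ι).left ⟶ 𝒳.left), ∃ (_ : Nonempty (ComplexPoints (base W))) (hπ : IsSmoothProjectiveFamily π 2) (_ : IsQuasiProjectiveOver 𝒳) (_ : IsQuasiProjectiveOver (base W)) (_ : AlgebraicGeometry.SmoothOfRelativeDimension (Fintype.card (CIdx e)) (base W).hom) (hτπ : τ ≫ π = π) (hjπ : j ≫ π = π) (_ :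 τ ≫ τ ≫ τ ≫ τ = 𝟙 𝒳) (_ : j ≫ j = τ ≫ τ) (_ : τ ≫ j ≫ τ = j) (_ : IsOpenImmersion ι) (_ : ι ≫ π.left = (snd (deckChart (fun i => (MvPolynomial.X i : ParamRing e))) (Over.mk W.ι)).left) (_ : ((Over.isoMk ((deckAction (fun i => (MvPolynomial.X i : ParamRing e))).aut (QuaternionGroup.a 1)) ((deckAction (fun i => (MvPolynomial.X i : ParamRing e))).aut_comp (QuaternionGroup.a 1))).hom ▷ Over.mk W.ι).left ≫ ι = ι ≫ τ.left) (_ : ((Over.isoMk ((deckAction (fun i => (MvPolynomial.X i : ParamRing e))).aut (QuaternionGroup.xa 0)) ((deckAction (fun i => (MvPolynomial.X i : ParamRing e))).aut_comp (QuaternionGroup.xa 0))).hom ▷ Over.mk W.ι).left ≫ ι = ι ≫ j.left) (_ : Function.Surjective (snd (deckChart (fun i => (MvPolynomial.X i : ParamRing e))) (Over.mk W.ι)).left), ∀ (hU : IsCohomologicallyLocallyTrivialOn π Set.univ), (∀ s : ComplexPoints (base W), let Xs := fiberOver π s; let hXs : IsSmoothProjective 2 Xs := hπ.isSmoothProjective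 s; let A : bettiCohomology Xs 2 →ₗ[ℚ] bettiCohomology Xs 2 := pull (fiberOverEnd π τ hτπ s) 2; let Qf : LinearMap.BilinForm ℚ (bettiCohomology Xs 2) := LinearMap.compr₂ (cup Xs 2 2) (tr hXs (2 + 2)); let Γ := ratMonodromyGroup π 2 hU ⟨s, Set.mem_univ s⟩; let N : Submodule ℚ (bettiCohomology Xs 2) := Submodule.span ℚ {x | ∃ Γ' : Subgroup (bettiCohomology Xs 2 ≃ₗ[ℚ] bettiCohomology Xs 2), Γ' ≤ Γ ∧ (Γ'.subgroupOf Γ).FiniteIndex ∧ ∀ γ ∈ Γ', γ x = x}; let Mv : Submodule ℚ (bettiCohomology Xs 2) := Module.End.eigenspace (A ^ 2) (-1) ⊓ Qf.orthogonal N; let Miv : Submodule ℂ (TensorProduct ℚ ℂ (bettiCohomology Xs 2)) := Mv.baseChange ℂ ⊓ Module.End.eigenspace (A.baseChange ℂ) Complex.I; Module.finrank ℂ ↥(Module.End.eigenspace ((A ^ 2).baseChange ℂ) 1 ⊓ (hodge exists_isReal_hodgeModel_holds hXs 2).piece 2 0) = 0 ∧ 0 < Module.finrank ℂ ↥(Module.End.eigenspace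 ((A ^ 2).baseChange ℂ) (-1) ⊓ (hodge exists_isReal_hodgeModel_holds hXs 2).piece 2 0) ∧ (N.baseChange ℂ ⊓ (hodge exists_isReal_hodgeModel_holds hXs 2).piece 2 0 = ⊥) ∧ 6 ≤ Module.finrank ℂ Miv ∧ (∀ Γ' : Subgroup (bettiCohomology Xs 2 ≃ₗ[ℚ] bettiCohomology Xs 2), Γ' ≤ Γ → (Γ'.subgroupOf Γ).FiniteIndex → ∀ F : Submodule ℂ (TensorProduct ℚ ℂ (bettiCohomology Xs 2)), F ≤ Miv → (∀ γ ∈ Γ', ∀ x ∈ F, (γ.toLinearMap.baseChange ℂ) x ∈ F) → F = ⊥ ∨ F = Miv) ∧ N ≤ Module.End.eigenspace (A ^ 2) 1) ∧ (∀ s : ComplexPoints (base W), let Xs := fiberOver π s; let hXs : IsSmoothProjective 2 Xs := hπ.isSmoothProjective s; let A : bettiCohomology Xs 2 →ₗ[ℚ] bettiCohomology Xs 2 := pull (fiberOverEnd π τ hτπ s) 2; let B : bettiCohomology Xs 2 →ₗ[ℚ] bettiCohomology Xs 2 := pull (fiberOverEnd π j hjπ s) 2; let Qf : LinearMap.BilinForm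 ℚ (bettiCohomology Xs 2) := LinearMap.compr₂ (cup Xs 2 2) (tr hXs (2 + 2)); let Γ := ratMonodromyGroup π 2 hU ⟨s, Set.mem_univ s⟩; ∃ γ ∈ Γ, ∃ ℓp ℓm : TensorProduct ℚ ℂ (bettiCohomology Xs 2), ℓp ∈ (Module.End.eigenspace (A ^ 2) (-1)).baseChange ℂ ∧ ℓm ∈ (Module.End.eigenspace (A ^ 2) (-1)).baseChange ℂ ∧ A.baseChange ℂ ℓp = Complex.I • ℓp ∧ A.baseChange ℂ ℓm = Complex.I • ℓm ∧ (Qf.baseChange ℂ) ℓp (B.baseChange ℂ ℓm) ≠ 0 ∧ (γ.toLinearMap.baseChange ℂ) ℓp = Complex.I • ℓp ∧ (γ.toLinearMap.baseChange ℂ) ℓm = (-Complex.I) • ℓm ∧ ∀ x ∈ (Module.End.eigenspace (A ^ 2) (-1)).baseChange ℂ, A.baseChange ℂ x = Complex.I • x → (Qf.baseChange ℂ) x (B.baseChange ℂ ℓp) = 0 → (Qf.baseChange ℂ) x (B.baseChange ℂ ℓm) = 0 → (γ.toLinearMap.baseChange ℂ) x = x)) → ∃ G : ℕ → MvPolynomial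 ({d : Fin 3 →₀ ℕ // d.degree = 1} ⊕ {d : Fin 3 →₀ ℕ // d.degree = e - 1}) ℂ, (∀ i, ∃ c ψ : MvPolynomial (Fin 3) ℂ, c.IsHomogeneous 1 ∧ ψ.IsHomogeneous (e - 1) ∧ MvPolynomial.rename (Equiv.swap (0 : Fin 3) 1) ψ = ψ ∧ MvPolynomial.eval (Sum.elim (fun d => c.coeff d.1) (fun d => ψ.coeff d.1)) (G i) ≠ 0) ∧ ∀ c ψ : MvPolynomial (Fin 3) ℂ, c.IsHomogeneous 1 → ψ.IsHomogeneous (e - 1) → MvPolynomial.rename (Equiv.swap (0 : Fin 3) 1) ψ = ψ → (∀ i, MvPolynomial.eval (Sum.elim (fun d => c.coeff d.1) (fun d => ψ.coeff d.1)) (G i) ≠ 0) → ∀ ⦃V X : SchemeOver ℂ⦄ (hX : IsSmoothProjective 2 X), IsHypersurfaceCutOutBy 3 (MvPolynomial.X (Fin.last 3) ^ 4 * MvPolynomial.X (Fin.castSucc 2) ^ (2 * e) - MvPolynomial.rename Fin.castSucc (c * MvPolynomial.rename (Equiv.swap (0 : Fin 3) 1) c ^ 3 * ((MvPolynomial.X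 0 - MvPolynomial.X 1) * ψ) ^ 2)) V → AlgebraicGeometry.Scheme.BirationalOver X.hom V.hom → Module.finrank ℚ (bettiCohomology X 1) = 0 ∧ ∀ τ j : X ⟶ X, (pull τ 2 ^ 4 = 1 ∧ pull j 2 ^ 2 = pull τ 2 ^ 2 ∧ pull j 2 * pull τ 2 = pull τ 2 ^ 3 * pull j 2 ∧ Module.finrank ℂ ↥(Module.End.eigenspace ((pull τ 2 ^ 2).baseChange ℂ) 1 ⊓ (hodge exists_isReal_hodgeModel_holds hX 2).piece 2 0) = 0 ∧ 0 < Module.finrank ℂ ↥(Module.End.eigenspace ((pull τ 2 ^ 2).baseChange ℂ) (-1) ⊓ (hodge exists_isReal_hodgeModel_holds hX 2).piece 2 0)) → Comm X hX τ j := by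
  intro Uni Comm e he h4 h₁ h₉
  have hC := transportHeredity_at @hcdk @hdel Summit.HodgeConjecture.HodgeConjecture.Theorems.Q8SymplecticPowersAutFreeReduction.stub_autFreeReductionQ he h4 h₉
  obtain ⟨G₁, hG₁₀, hG₁⟩ := h₁
  obtain ⟨G₂, hG₂₀, hG₂⟩ := hC
  refine ⟨fun n => if n % 2 = 0 then G₁ (n / 2) else G₂ (n / 2), ?_, ?_⟩
  · intro i
    by_cases hi : i % 2 = 0
    · simp only [if_pos hi]; exact hG₁₀ _
    · simp only [if_neg hi]; exact hG₂₀ _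
  · intro c ψ hc hψ hinv hgen V X hX hcut hbir
    have hg₁ : ∀ i, MvPolynomial.eval (Sum.elim (fun d => c.coeff d.1) (fun d => ψ.coeff d.1)) (G₁ i) ≠ 0 := by
      intro i
      have h := hgen (2 * i)
      have e1 : (2 * i) % 2 = 0 := by omega
      have e2 : (2 * i) / 2 = i := by omega
      simp only [if_pos e1, e2] at h
      exact h
    have hg₂ : ∀ i, MvPolynomial.eval (Sum.elim (fun d => c.coeff d.1) (fun d => ψ.coeff d.1)) (G₂ i) ≠ 0 := by
      intro i
      have h := hgen (2 * i + 1)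
      have e1 : ¬ ((2 * i + 1) % 2 = 0) := by omega
      have e2 : (2 * i + 1) / 2 = i := by omega
      simp only [if_neg e1, e2] at h
      exact h
    exact ⟨hG₁ c ψ hc hψ hinv hg₁ hX hcut hbir, hG₂ c ψ hc hψ hinv hg₂ hX hcut hbir⟩

/-- **The `e = 4` case of the crux from `e = 4` inputs only**: S1 at `e = 4`, the registered member local certificate LCERT₄
(`stub_memberLocalCertificateQ4`, verbatim — it yields the `∃`-family at `e = 4` through p731940 → p733014 (FACT B) → p730189-minus-Kollár),
CDK, Deligne 1987. No LCERT_{≥6}, no Kollár. [cite: CattaniDeligneKaplan1995, Thm. 1.1 and Cor. 1.2] [cite: Deligne1987, Prop. 1.13] -/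
theorem K1Q_at_four_of_residues
    (h₁ : open Literature.AlgebraicGeometry.Motives Literature.AlgebraicGeometry.HodgeTheory Literature.AlgebraicGeometry.HodgeTheory.BettiUniverse Literature.AlgebraicGeometry.HodgeTheory.Q8Family Literature.AlgebraicGeometry.RelativeSpec Literature.AlgebraicGeometry.RelativeSpec.ActionOver Literature.Algebra.Lie Literature.Algebra.Lie.KatzRecognition CategoryTheory CategoryTheory.Limits MonoidalCategory CartesianMonoidalCategory AlgebraicGeometry in ∀ ⦃e : ℕ⦄, e = 4 → ∃ G : ℕ → MvPolynomial ({d : Fin 3 →₀ ℕ // d.degree = 1} ⊕ {d : Fin 3 →₀ ℕ // d.degree = e - 1}) ℂ, (∀ i, ∃ c ψ : MvPolynomial (Fin 3) ℂ, c.IsHomogeneous 1 ∧ ψ.IsHomogeneous (e - 1) ∧ MvPolynomial.rename (Equiv.swap (0 : Fin 3) 1) ψ = ψ ∧ MvPolynomial.eval (Sum.elim (fun d => c.coeff d.1) (fun d => ψ.coeff d.1)) (G i) ≠ 0) ∧ ∀ c ψ : MvPolynomial (Fin 3) ℂ, c.IsHomogeneous 1 → ψ.IsHomogeneous (e - 1)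 → MvPolynomial.rename (Equiv.swap (0 : Fin 3) 1) ψ = ψ → (∀ i, MvPolynomial.eval (Sum.elim (fun d => c.coeff d.1) (fun d => ψ.coeff d.1)) (G i) ≠ 0) → ∀ ⦃V X : SchemeOver ℂ⦄ (hX : IsSmoothProjective 2 X), IsHypersurfaceCutOutBy 3 (MvPolynomial.X (Fin.last 3) ^ 4 * MvPolynomial.X (Fin.castSucc 2) ^ (2 * e) - MvPolynomial.rename Fin.castSucc (c * MvPolynomial.rename (Equiv.swap (0 : Fin 3) 1) c ^ 3 * ((MvPolynomial.X 0 - MvPolynomial.X 1) * ψ) ^ 2)) V → AlgebraicGeometry.Scheme.BirationalOver X.hom V.hom → Module.finrank ℚ (bettiCohomology X 1) = 0)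
    (h₉₄ : open Literature.AlgebraicGeometry.Motives Literature.AlgebraicGeometry.HodgeTheory Literature.AlgebraicGeometry.HodgeTheory.BettiUniverse Literature.AlgebraicGeometry.HodgeTheory.Q8Family Literature.AlgebraicGeometry.RelativeSpec Literature.AlgebraicGeometry.RelativeSpec.ActionOver CategoryTheory CategoryTheory.Limits MonoidalCategory CartesianMonoidalCategory AlgebraicGeometry Literature.AlgebraicTopology.SingularHomology in ∀ ⦃e : ℕ⦄, e = 4 → ∃ (W : (Spec (.of (ParamRing e))).Opens) (𝒳 : SchemeOver ℂ) (π : 𝒳 ⟶ base W) (τ j : 𝒳 ⟶ 𝒳) (ι : (deckChart (fun i => (MvPolynomial.X i : ParamRing e)) ⊗ Over.mk W.ι).left ⟶ 𝒳.left), ∃ (_ : Nonempty (ComplexPoints (base W))) (hπ : IsSmoothProjectiveFamily π 2) (_ : IsQuasiProjectiveOver 𝒳) (_ : IsQuasiProjectiveOver (base W)) (_ : AlgebraicGeometry.SmoothOfRelativeDimension (Fintype.card (CIdx e)) (base W).hom) (hτπ : τ ≫ π = π) (hjπ : j ≫ π = π) (_ : τ ≫ τ ≫ τ ≫ τ = 𝟙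 𝒳) (_ : j ≫ j = τ ≫ τ) (_ : τ ≫ j ≫ τ = j) (_ : IsOpenImmersion ι) (_ : ι ≫ π.left = (snd (deckChart (fun i => (MvPolynomial.X i : ParamRing e))) (Over.mk W.ι)).left) (_ : ((Over.isoMk ((deckAction (fun i => (MvPolynomial.X i : ParamRing e))).aut (QuaternionGroup.a 1)) ((deckAction (fun i => (MvPolynomial.X i : ParamRing e))).aut_comp (QuaternionGroup.a 1))).hom ▷ Over.mk W.ι).left ≫ ι = ι ≫ τ.left) (_ : ((Over.isoMk ((deckAction (fun i => (MvPolynomial.X i : ParamRing e))).aut (QuaternionGroup.xa 0)) ((deckAction (fun i => (MvPolynomial.X i : ParamRing e))).aut_comp (QuaternionGroup.xa 0))).hom ▷ Over.mk W.ι).left ≫ ι = ι ≫ j.left) (_ : Function.Surjective (snd (deckChart (fun i => (MvPolynomial.X i : ParamRing e))) (Over.mk W.ι)).left), ∀ (hU : IsCohomologicallyLocallyTrivialOn π Set.univ), ∃ (b : ComplexPoints (base W)) (ψ : OpenPartialHomeomorph (Set.univ : Set (ComplexPoints (base W))) (Fin (Fintype.card (CIdx e)) → ℂ)) (W₀ :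 Set (Set.univ : Set (ComplexPoints (base W)))) (ω : (Fin (Fintype.card (CIdx e)) → ℂ) → TensorProduct ℚ ℂ (bettiCohomology (fiberOver π b) 2)) (r : ℕ), IsOpen W₀ ∧ (⟨b, Set.mem_univ b⟩ : (Set.univ : Set (ComplexPoints (base W)))) ∈ W₀ ∧ W₀ ⊆ ψ.source ∧ (let Xb := fiberOver π b; let hXb : IsSmoothProjective 2 Xb := hπ.isSmoothProjective b; let Ab : bettiCohomology Xb 2 →ₗ[ℚ] bettiCohomology Xb 2 := pull (fiberOverEnd π τ hτπ b) 2; let Mb : Submodule ℂ (TensorProduct ℚ ℂ (bettiCohomology Xb 2)) := Module.End.eigenspace (Ab.baseChange ℂ) Complex.I; Module.finrank ℂ ↥(Module.End.eigenspace ((Ab ^ 2).baseChange ℂ) 1 ⊓ (hodge exists_isReal_hodgeModel_holds hXb 2).piece 2 0) = 0 ∧ 0 < Module.finrank ℂ ↥(Module.End.eigenspace ((Ab ^ 2).baseChange ℂ) (-1) ⊓ (hodge exists_isReal_hodgeModel_holds hXb 2).piece 2 0) ∧ 6 ≤ Module.finrank ℂ ↥Mb ∧ Module.finrank ℂ ↥(Mb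 ⊓ (hodge exists_isReal_hodgeModel_holds hXb 2).F 2) ≤ 1 ∧ (∀ t ∈ W₀, ∀ (ε : Path (⟨b, Set.mem_univ b⟩ : (Set.univ : Set (ComplexPoints (base W)))) t), (∀ r', ε r' ∈ W₀) → ∀ (T : bettiCohomology Xb 2 ≃ₗ[ℚ] bettiCohomology (fiberOver π t.1) 2), (∀ v, ofRatClass _ 2 (T v) = transportFun π 2 hU ⟦ε⟧ (ofRatClass _ 2 v)) → ω (ψ t) ∈ Mb ⊓ ((hodge exists_isReal_hodgeModel_holds (hπ.isSmoothProjective t.1) 2).comapEquiv T).F 2) ∧ (∀ φ : Module.Dual ℂ (TensorProduct ℚ ℂ (bettiCohomology Xb 2)), (∀ i ≤ r, iteratedFDeriv ℂ i (fun z ↦ φ (ω z)) (ψ ⟨b, Set.mem_univ b⟩) = 0) → ∀ m ∈ Mb, φ m = 0)) ∧ ∃ (γ : bettiCohomology (fiberOver π b) 2 ≃ₗ[ℚ] bettiCohomology (fiberOver π b) 2), γ ∈ ratMonodromyGroup π 2 hU ⟨b, Set.mem_univ b⟩ ∧ (∃ a, pull (fiberOverEnd π τ hτπ b) 2 (pull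 (fiberOverEnd π τ hτπ b) 2 a) = -a ∧ γ a ≠ a) ∧ ∃ (h : ComplexPoints (fiberOver π b) ≃ₜ ComplexPoints (fiberOver π b)), (∀ a, γ a = (singularCohomology.map ℚ ℚ (h : C(ComplexPoints (fiberOver π b), ComplexPoints (fiberOver π b))) 2).hom a) ∧ singularHomology.map ℚ ℚ (h : C(ComplexPoints (fiberOver π b), ComplexPoints (fiberOver π b))) 4 (complexOrientationRat (hπ.isSmoothProjective b)).fundamentalClass = (complexOrientationRat (hπ.isSmoothProjective b)).fundamentalClass ∧ (∀ x, h ((AlgPoints.mapContinuous (L := ℂ) (fiberOverEnd π τ hτπ b)) x) = (AlgPoints.mapContinuous (L := ℂ) (fiberOverEnd π τ hτπ b)) (h x)) ∧ ∃ (A₁ A₂ B : Set (ComplexPoints (fiberOver π b))), IsOpen A₁ ∧ IsOpen A₂ ∧ IsOpen B ∧ A₁ ∪ A₂ ∪ B = Set.univ ∧ Disjoint (closure A₁) A₂ ∧ (∀ x ∈ B, h x = x) ∧ ∃ (hhA₁ : Set.MapsTo (h : C(ComplexPoints (fiberOver π b), ComplexPoints (fiberOver π b))) A₁ A₁) (hhA₂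 : Set.MapsTo (h : C(ComplexPoints (fiberOver π b), ComplexPoints (fiberOver π b))) A₂ A₂) (hτA₁ : Set.MapsTo (AlgPoints.mapContinuous (L := ℂ) (fiberOverEnd π τ hτπ b)) A₁ A₁) (hτA₂ : Set.MapsTo (AlgPoints.mapContinuous (L := ℂ) (fiberOverEnd π τ hτπ b)) A₂ A₂) (_ : Set.MapsTo (AlgPoints.mapContinuous (L := ℂ) (fiberOverEnd π j hjπ b)) A₁ A₂) (_ : Set.MapsTo (AlgPoints.mapContinuous (L := ℂ) (fiberOverEnd π j hjπ b)) A₂ A₁) (_ : Module.Finite ℚ (singularHomology ℚ ℚ (↥A₁) 2)) (_ : Module.Finite ℚ (singularHomology ℚ ℚ (↥A₂) 2)), Module.finrank ℚ ↥(Module.End.eigenspace ((singularHomology.map ℚ ℚ (singularHomology.restrictSelf (AlgPoints.mapContinuous (L := ℂ) (fiberOverEnd π τ hτπ b)) hτA₁) 2).hom ^ 2) (-1 : ℚ)) ≤ 2 ∧ (∀ a : singularHomology ℚ ℚ (↥A₁) 2, singularHomology.map ℚ ℚ (singularHomology.restrictSelf (AlgPoints.mapContinuous (L := ℂ) (fiberOverEnd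 π τ hτπ b)) hτA₁) 2 (singularHomology.map ℚ ℚ (singularHomology.restrictSelf (AlgPoints.mapContinuous (L := ℂ) (fiberOverEnd π τ hτπ b)) hτA₁) 2 a) = -a → singularHomology.map ℚ ℚ (singularHomology.restrictSelf (h : C(ComplexPoints (fiberOver π b), ComplexPoints (fiberOver π b))) hhA₁) 2 a = singularHomology.map ℚ ℚ (singularHomology.restrictSelf (AlgPoints.mapContinuous (L := ℂ) (fiberOverEnd π τ hτπ b)) hτA₁) 2 a) ∧ (∀ a : singularHomology ℚ ℚ (↥A₂) 2, singularHomology.map ℚ ℚ (singularHomology.restrictSelf (AlgPoints.mapContinuous (L := ℂ) (fiberOverEnd π τ hτπ b)) hτA₂) 2 (singularHomology.map ℚ ℚ (singularHomology.restrictSelf (AlgPoints.mapContinuous (L := ℂ) (fiberOverEnd π τ hτπ b)) hτA₂) 2 a) = -a → singularHomology.map ℚ ℚ (singularHomology.restrictSelf (h : C(ComplexPoints (fiberOver π b), ComplexPoints (fiberOver π b))) hhA₂) 2 (singularHomology.map ℚ ℚ (singularHomology.restrictSelf (AlgPoints.mapContinuous (L := ℂ) (fiberOverEnd π τ hτπ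 b)) hτA₂) 2 a) = a))
    (hcdk : open Literature.AlgebraicGeometry.HodgeTheory in cmsp_nonHodgeGenericPoints_countable_algebraic_cover)
    (hdel : Literature.AlgebraicGeometry.HodgeTheory.deligne1987_monodromy_directSum_irreducible_subvariations) :
    open Literature.AlgebraicGeometry.Motives Literature.AlgebraicGeometry.HodgeTheory Literature.AlgebraicGeometry.HodgeTheory.BettiUniverse Literature.AlgebraicGeometry.HodgeTheory.Q8Family Literature.AlgebraicGeometry.RelativeSpec Literature.AlgebraicGeometry.RelativeSpec.ActionOver Literature.Algebra.Lie Literature.Algebra.Lie.KatzRecognition CategoryTheory CategoryTheory.Limits MonoidalCategory CartesianMonoidalCategory AlgebraicGeometry in let Uni : (X : SchemeOver ℂ) → IsSmoothProjective 2 X → (X ⟶ X) → (X ⟶ X) → (bettiCohomology X 2 ≃ₗ[ℚ] bettiCohomology X 2) → Prop := fun X hX τ j g => (∀ x, g (pull τ 2 x) = pull τ 2 (g x)) ∧ (∀ x, g (pull j 2 x) = pull j 2 (g x)) ∧ (∀ x y, tr hX (2 + 2) (cup X 2 2 (g x) (g y)) = tr hX (2 + 2) (cup X 2 2 x y)) ∧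 ∀ x ∈ (hodge exists_isReal_hodgeModel_holds hX 2).hodgeClasses 1, g x = x; let Comm : (X : SchemeOver ℂ) → IsSmoothProjective 2 X → (X ⟶ X) → (X ⟶ X) → Prop := fun X hX τ j => haveI := finite hX 2; haveI : HodgeTensorFacts.{0, 0} := hodgeTensorFacts_holds; ∀ g h : bettiCohomology X 2 ≃ₗ[ℚ] bettiCohomology X 2, Uni X hX τ j g → Uni X hX τ j h → g * h * g⁻¹ * h⁻¹ ∈ (hodge exists_isReal_hodgeModel_holds hX 2).hodgeGroup; ∀ ⦃e : ℕ⦄, e = 4 → ∃ G : ℕ → MvPolynomial ({d : Fin 3 →₀ ℕ // d.degree = 1} ⊕ {d : Fin 3 →₀ ℕ // d.degree = e - 1}) ℂ, (∀ i, ∃ c ψ : MvPolynomial (Fin 3) ℂ, c.IsHomogeneous 1 ∧ ψ.IsHomogeneous (e - 1) ∧ MvPolynomial.rename (Equiv.swap (0 : Fin 3) 1) ψ = ψ ∧ MvPolynomial.eval (Sum.elim (fun d => c.coeff d.1) (fun d => ψ.coeff d.1)) (G i) ≠ 0) ∧ ∀ c ψ : MvPolynomial (Fin 3) ℂ, c.IsHomogeneous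 1 → ψ.IsHomogeneous (e - 1) → MvPolynomial.rename (Equiv.swap (0 : Fin 3) 1) ψ = ψ → (∀ i, MvPolynomial.eval (Sum.elim (fun d => c.coeff d.1) (fun d => ψ.coeff d.1)) (G i) ≠ 0) → ∀ ⦃V X : SchemeOver ℂ⦄ (hX : IsSmoothProjective 2 X), IsHypersurfaceCutOutBy 3 (MvPolynomial.X (Fin.last 3) ^ 4 * MvPolynomial.X (Fin.castSucc 2) ^ (2 * e) - MvPolynomial.rename Fin.castSucc (c * MvPolynomial.rename (Equiv.swap (0 : Fin 3) 1) c ^ 3 * ((MvPolynomial.X 0 - MvPolynomial.X 1) * ψ) ^ 2)) V → AlgebraicGeometry.Scheme.BirationalOver X.hom V.hom → Module.finrank ℚ (bettiCohomology X 1) = 0 ∧ ∀ τ j : X ⟶ X, (pull τ 2 ^ 4 = 1 ∧ pull j 2 ^ 2 = pull τ 2 ^ 2 ∧ pull j 2 * pull τ 2 = pull τ 2 ^ 3 * pull j 2 ∧ Module.finrank ℂ ↥(Module.End.eigenspace ((pull τ 2 ^ 2).baseChange ℂ) 1 ⊓ (hodge exists_isReal_hodgeModel_holds hX 2).piece 2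 0) = 0 ∧ 0 < Module.finrank ℂ ↥(Module.End.eigenspace ((pull τ 2 ^ 2).baseChange ℂ) (-1) ⊓ (hodge exists_isReal_hodgeModel_holds hX 2).piece 2 0)) → Comm X hX τ j := by
  intro Uni Comm e he4
  have he : Even e := ⟨2, by omega⟩
  have h4 : 4 ≤ e := by omega
  have h₉ := Q8SymplecticPowersK1QOfStubsKollarFree.certifiedDeckFamilyQ4_of_member_kollarFree
    (Q8SymplecticPowersMemberDataOfCertificatesFactB.stub_memberDataQ4_of_jetSpan_clause hdel
      (Q8SymplecticPowersMemberCertificateOfKerDatum.stub_memberCertificateQ4_of_localConfiguration h₉₄)) he4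
  exact K1Q_at_of_stubs_at @hcdk @hdel he h4 (h₁ he4) h₉

/-- **The even `e ≥ 6` cases of the crux** from S1 at `e`, the registered LCERT_{≥6} (`stub_memberLocalCertificateQge6`, verbatim),
CDK, Deligne 1987. [cite: CattaniDeligneKaplan1995, Thm. 1.1 and Cor. 1.2] [cite: Deligne1987, Prop. 1.13] -/
theorem K1Q_at_ge6_of_residues
    (h₁ : open Literature.AlgebraicGeometry.Motives Literature.AlgebraicGeometry.HodgeTheory Literature.AlgebraicGeometry.HodgeTheory.BettiUniverse Literature.AlgebraicGeometry.HodgeTheory.Q8Family Literature.AlgebraicGeometry.RelativeSpec Literature.AlgebraicGeometry.RelativeSpec.ActionOver Literature.Algebra.Lie Literature.Algebra.Lie.KatzRecognition CategoryTheory CategoryTheory.Limits MonoidalCategory CartesianMonoidalCategory AlgebraicGeometry in ∀ ⦃e : ℕ⦄, Even e → 6 ≤ e → ∃ G : ℕ → MvPolynomial ({d : Fin 3 →₀ ℕ // d.degree = 1} ⊕ {d : Fin 3 →₀ ℕ // d.degree = e - 1}) ℂ, (∀ i, ∃ c ψ : MvPolynomial (Fin 3) ℂ, c.IsHomogeneous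 1 ∧ ψ.IsHomogeneous (e - 1) ∧ MvPolynomial.rename (Equiv.swap (0 : Fin 3) 1) ψ = ψ ∧ MvPolynomial.eval (Sum.elim (fun d => c.coeff d.1) (fun d => ψ.coeff d.1)) (G i) ≠ 0) ∧ ∀ c ψ : MvPolynomial (Fin 3) ℂ, c.IsHomogeneous 1 → ψ.IsHomogeneous (e - 1) → MvPolynomial.rename (Equiv.swap (0 : Fin 3) 1) ψ = ψ → (∀ i, MvPolynomial.eval (Sum.elim (fun d => c.coeff d.1) (fun d => ψ.coeff d.1)) (G i) ≠ 0) → ∀ ⦃V X : SchemeOver ℂ⦄ (hX : IsSmoothProjective 2 X), IsHypersurfaceCutOutBy 3 (MvPolynomial.X (Fin.last 3) ^ 4 * MvPolynomial.X (Fin.castSucc 2) ^ (2 * e) - MvPolynomial.rename Fin.castSucc (c * MvPolynomial.rename (Equiv.swap (0 : Fin 3) 1) c ^ 3 * ((MvPolynomial.X 0 - MvPolynomial.X 1) * ψ) ^ 2)) V → AlgebraicGeometry.Scheme.BirationalOver X.hom V.hom → Module.finrank ℚ (bettiCohomology X 1) = 0)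
    (h₉₆ : open Literature.AlgebraicGeometry.Motives Literature.AlgebraicGeometry.HodgeTheory Literature.AlgebraicGeometry.HodgeTheory.BettiUniverse Literature.AlgebraicGeometry.HodgeTheory.Q8Family Literature.AlgebraicGeometry.RelativeSpec Literature.AlgebraicGeometry.RelativeSpec.ActionOver CategoryTheory CategoryTheory.Limits MonoidalCategory CartesianMonoidalCategory AlgebraicGeometry Literature.AlgebraicTopology.SingularHomology in ∀ ⦃e : ℕ⦄, Even e → 6 ≤ e → ∃ (W : (Spec (.of (ParamRing e))).Opens) (𝒳 : SchemeOver ℂ) (π : 𝒳 ⟶ base W) (τ j : 𝒳 ⟶ 𝒳) (ι : (deckChart (fun i => (MvPolynomial.X i : ParamRing e)) ⊗ Over.mk W.ι).left ⟶ 𝒳.left), ∃ (_ : Nonempty (ComplexPoints (base W))) (hπ : IsSmoothProjectiveFamily π 2) (_ : IsQuasiProjectiveOver 𝒳) (_ : IsQuasiProjectiveOver (base W)) (_ : AlgebraicGeometry.SmoothOfRelativeDimension (Fintype.card (CIdx e)) (base W).hom) (hτπ : τ ≫ π = π) (hjπ : j ≫ π = π) (_ : τ ≫ τ ≫ τ ≫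 τ = 𝟙 𝒳) (_ : j ≫ j = τ ≫ τ) (_ : τ ≫ j ≫ τ = j) (_ : IsOpenImmersion ι) (_ : ι ≫ π.left = (snd (deckChart (fun i => (MvPolynomial.X i : ParamRing e))) (Over.mk W.ι)).left) (_ : ((Over.isoMk ((deckAction (fun i => (MvPolynomial.X i : ParamRing e))).aut (QuaternionGroup.a 1)) ((deckAction (fun i => (MvPolynomial.X i : ParamRing e))).aut_comp (QuaternionGroup.a 1))).hom ▷ Over.mk W.ι).left ≫ ι = ι ≫ τ.left) (_ : ((Over.isoMk ((deckAction (fun i => (MvPolynomial.X i : ParamRing e))).aut (QuaternionGroup.xa 0)) ((deckAction (fun i => (MvPolynomial.X i : ParamRing e))).aut_comp (QuaternionGroup.xa 0))).hom ▷ Over.mk W.ι).left ≫ ι = ι ≫ j.left) (_ : Function.Surjective (snd (deckChart (fun i => (MvPolynomial.X i : ParamRing e))) (Over.mk W.ι)).left), ∀ (hU : IsCohomologicallyLocallyTrivialOn π Set.univ), ∃ (b : ComplexPoints (base W)) (ψ : OpenPartialHomeomorph (Set.univ : Set (ComplexPoints (base W))) (Fin (Fintype.card (CIdx e)) → ℂ))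 (W₀ : Set (Set.univ : Set (ComplexPoints (base W)))) (ι₁ ι₂ : Type) (ω : (Fin (Fintype.card (CIdx e)) → ℂ) → ι₁ → TensorProduct ℚ ℂ (bettiCohomology (fiberOver π b) 2)) (η : (Fin (Fintype.card (CIdx e)) → ℂ) → ι₂ → Module.Dual ℂ (TensorProduct ℚ ℂ (bettiCohomology (fiberOver π b) 2))) (r : ℕ), IsOpen W₀ ∧ (⟨b, Set.mem_univ b⟩ : (Set.univ : Set (ComplexPoints (base W)))) ∈ W₀ ∧ W₀ ⊆ ψ.source ∧ (let Xb := fiberOver π b; let hXb : IsSmoothProjective 2 Xb := hπ.isSmoothProjective b; let Ab : bettiCohomology Xb 2 →ₗ[ℚ] bettiCohomology Xb 2 := pull (fiberOverEnd π τ hτπ b) 2; let Mb : Submodule ℂ (TensorProduct ℚ ℂ (bettiCohomology Xb 2)) := Module.End.eigenspace (Ab.baseChange ℂ) Complex.I; Module.finrank ℂ ↥(Module.End.eigenspace ((Ab ^ 2).baseChange ℂ) 1 ⊓ (hodge exists_isReal_hodgeModel_holds hXb 2).piece 2 0) = 0 ∧ 0 < Module.finrank ℂ ↥(Module.End.eigenspace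 ((Ab ^ 2).baseChange ℂ) (-1) ⊓ (hodge exists_isReal_hodgeModel_holds hXb 2).piece 2 0) ∧ 6 ≤ Module.finrank ℂ ↥Mb ∧ (∀ t ∈ W₀, ∀ (ε : Path (⟨b, Set.mem_univ b⟩ : (Set.univ : Set (ComplexPoints (base W)))) t), (∀ r', ε r' ∈ W₀) → ∀ (T : bettiCohomology Xb 2 ≃ₗ[ℚ] bettiCohomology (fiberOver π t.1) 2), (∀ v, ofRatClass _ 2 (T v) = transportFun π 2 hU ⟦ε⟧ (ofRatClass _ 2 v)) → ∀ i, ω (ψ t) i ∈ Mb ⊓ ((hodge exists_isReal_hodgeModel_holds (hπ.isSmoothProjective t.1) 2).comapEquiv T).F 2) ∧ (∀ t ∈ W₀, ∀ (ε : Path (⟨b, Set.mem_univ b⟩ : (Set.univ : Set (ComplexPoints (base W)))) t), (∀ r', ε r' ∈ W₀) → ∀ (T : bettiCohomology Xb 2 ≃ₗ[ℚ] bettiCohomology (fiberOver π t.1) 2), (∀ v, ofRatClass _ 2 (T v) = transportFun π 2 hU ⟦ε⟧ (ofRatClass _ 2 v)) → ∀ l, ∀ x ∈ Mb ⊓ ((hodge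 exists_isReal_hodgeModel_holds (hπ.isSmoothProjective t.1) 2).comapEquiv T).F 2, η (ψ t) l x = 0) ∧ (∀ φ : (TensorProduct ℚ ℂ (bettiCohomology Xb 2)) →ₗ[ℂ] (TensorProduct ℚ ℂ (bettiCohomology Xb 2)), (∀ x ∈ Mb, φ x ∈ Mb) → (∀ i l, ∀ m ≤ r, iteratedFDeriv ℂ m (fun z ↦ η z l (φ (ω z i))) (ψ ⟨b, Set.mem_univ b⟩) = 0) → ∃ c : ℂ, ∀ x ∈ Mb, φ x = c • x)) ∧ ∃ (γ : bettiCohomology (fiberOver π b) 2 ≃ₗ[ℚ] bettiCohomology (fiberOver π b) 2), γ ∈ ratMonodromyGroup π 2 hU ⟨b, Set.mem_univ b⟩ ∧ (∃ a, pull (fiberOverEnd π τ hτπ b) 2 (pull (fiberOverEnd π τ hτπ b) 2 a) = -a ∧ γ a ≠ a) ∧ ∃ (h : ComplexPoints (fiberOver π b) ≃ₜ ComplexPoints (fiberOver π b)), (∀ a, γ a = (singularCohomology.map ℚ ℚ (h : C(ComplexPoints (fiberOver π b), ComplexPoints (fiberOver π b))) 2).hom a) ∧ singularHomology.map ℚ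 ℚ (h : C(ComplexPoints (fiberOver π b), ComplexPoints (fiberOver π b))) 4 (complexOrientationRat (hπ.isSmoothProjective b)).fundamentalClass = (complexOrientationRat (hπ.isSmoothProjective b)).fundamentalClass ∧ (∀ x, h ((AlgPoints.mapContinuous (L := ℂ) (fiberOverEnd π τ hτπ b)) x) = (AlgPoints.mapContinuous (L := ℂ) (fiberOverEnd π τ hτπ b)) (h x)) ∧ ∃ (A₁ A₂ B : Set (ComplexPoints (fiberOver π b))), IsOpen A₁ ∧ IsOpen A₂ ∧ IsOpen B ∧ A₁ ∪ A₂ ∪ B = Set.univ ∧ Disjoint (closure A₁) A₂ ∧ (∀ x ∈ B, h x = x) ∧ ∃ (hhA₁ : Set.MapsTo (h : C(ComplexPoints (fiberOver π b), ComplexPoints (fiberOver π b))) A₁ A₁) (hhA₂ : Set.MapsTo (h : C(ComplexPoints (fiberOver π b), ComplexPoints (fiberOver π b))) A₂ A₂) (hτA₁ : Set.MapsTo (AlgPoints.mapContinuous (L := ℂ) (fiberOverEnd π τ hτπ b)) A₁ A₁) (hτA₂ : Set.MapsTo (AlgPoints.mapContinuous (L := ℂ) (fiberOverEnd π τ hτπ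 b)) A₂ A₂) (_ : Set.MapsTo (AlgPoints.mapContinuous (L := ℂ) (fiberOverEnd π j hjπ b)) A₁ A₂) (_ : Set.MapsTo (AlgPoints.mapContinuous (L := ℂ) (fiberOverEnd π j hjπ b)) A₂ A₁) (_ : Module.Finite ℚ (singularHomology ℚ ℚ (↥A₁) 2)) (_ : Module.Finite ℚ (singularHomology ℚ ℚ (↥A₂) 2)), Module.finrank ℚ ↥(Module.End.eigenspace ((singularHomology.map ℚ ℚ (singularHomology.restrictSelf (AlgPoints.mapContinuous (L := ℂ) (fiberOverEnd π τ hτπ b)) hτA₁) 2).hom ^ 2) (-1 : ℚ)) ≤ 2 ∧ (∀ a : singularHomology ℚ ℚ (↥A₁) 2, singularHomology.map ℚ ℚ (singularHomology.restrictSelf (AlgPoints.mapContinuous (L := ℂ) (fiberOverEnd π τ hτπ b)) hτA₁) 2 (singularHomology.map ℚ ℚ (singularHomology.restrictSelf (AlgPoints.mapContinuous (L := ℂ) (fiberOverEnd π τ hτπ b)) hτA₁) 2 a) = -a → singularHomology.map ℚ ℚ (singularHomology.restrictSelf (h : C(ComplexPoints (fiberOver π b), ComplexPoints (fiberOver π b)))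 hhA₁) 2 a = singularHomology.map ℚ ℚ (singularHomology.restrictSelf (AlgPoints.mapContinuous (L := ℂ) (fiberOverEnd π τ hτπ b)) hτA₁) 2 a) ∧ (∀ a : singularHomology ℚ ℚ (↥A₂) 2, singularHomology.map ℚ ℚ (singularHomology.restrictSelf (AlgPoints.mapContinuous (L := ℂ) (fiberOverEnd π τ hτπ b)) hτA₂) 2 (singularHomology.map ℚ ℚ (singularHomology.restrictSelf (AlgPoints.mapContinuous (L := ℂ) (fiberOverEnd π τ hτπ b)) hτA₂) 2 a) = -a → singularHomology.map ℚ ℚ (singularHomology.restrictSelf (h : C(ComplexPoints (fiberOver π b), ComplexPoints (fiberOver π b))) hhA₂) 2 (singularHomology.map ℚ ℚ (singularHomology.restrictSelf (AlgPoints.mapContinuous (L := ℂ) (fiberOverEnd π τ hτπ b)) hτA₂) 2 a) = a))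
    (hcdk : open Literature.AlgebraicGeometry.HodgeTheory in cmsp_nonHodgeGenericPoints_countable_algebraic_cover)
    (hdel : Literature.AlgebraicGeometry.HodgeTheory.deligne1987_monodromy_directSum_irreducible_subvariations) :
    open Literature.AlgebraicGeometry.Motives Literature.AlgebraicGeometry.HodgeTheory Literature.AlgebraicGeometry.HodgeTheory.BettiUniverse Literature.AlgebraicGeometry.HodgeTheory.Q8Family Literature.AlgebraicGeometry.RelativeSpec Literature.AlgebraicGeometry.RelativeSpec.ActionOver Literature.Algebra.Lie Literature.Algebra.Lie.KatzRecognition CategoryTheory CategoryTheory.Limits MonoidalCategory CartesianMonoidalCategory AlgebraicGeometry in let Uni : (X : SchemeOver ℂ) → IsSmoothProjective 2 X → (X ⟶ X) → (X ⟶ X) → (bettiCohomology X 2 ≃ₗ[ℚ] bettiCohomology X 2) → Prop := fun X hX τ j g => (∀ x, g (pull τ 2 x) = pull τ 2 (g x)) ∧ (∀ x, g (pull j 2 x) = pull j 2 (g x)) ∧ (∀ x y, tr hX (2 + 2) (cup X 2 2 (g x) (g y)) = tr hX (2 + 2) (cup X 2 2 x y)) ∧ ∀ x ∈ (hodge exists_isReal_hodgeModel_holds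 hX 2).hodgeClasses 1, g x = x; let Comm : (X : SchemeOver ℂ) → IsSmoothProjective 2 X → (X ⟶ X) → (X ⟶ X) → Prop := fun X hX τ j => haveI := finite hX 2; haveI : HodgeTensorFacts.{0, 0} := hodgeTensorFacts_holds; ∀ g h : bettiCohomology X 2 ≃ₗ[ℚ] bettiCohomology X 2, Uni X hX τ j g → Uni X hX τ j h → g * h * g⁻¹ * h⁻¹ ∈ (hodge exists_isReal_hodgeModel_holds hX 2).hodgeGroup; ∀ ⦃e : ℕ⦄, Even e → 6 ≤ e → ∃ G : ℕ → MvPolynomial ({d : Fin 3 →₀ ℕ // d.degree = 1} ⊕ {d : Fin 3 →₀ ℕ // d.degree = e - 1}) ℂ, (∀ i, ∃ c ψ : MvPolynomial (Fin 3) ℂ, c.IsHomogeneous 1 ∧ ψ.IsHomogeneous (e - 1) ∧ MvPolynomial.rename (Equiv.swap (0 : Fin 3) 1) ψ = ψ ∧ MvPolynomial.eval (Sum.elim (fun d => c.coeff d.1) (fun d => ψ.coeff d.1)) (G i) ≠ 0) ∧ ∀ c ψ : MvPolynomial (Fin 3) ℂ, c.IsHomogeneous 1 → ψ.IsHomogeneous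 (e - 1) → MvPolynomial.rename (Equiv.swap (0 : Fin 3) 1) ψ = ψ → (∀ i, MvPolynomial.eval (Sum.elim (fun d => c.coeff d.1) (fun d => ψ.coeff d.1)) (G i) ≠ 0) → ∀ ⦃V X : SchemeOver ℂ⦄ (hX : IsSmoothProjective 2 X), IsHypersurfaceCutOutBy 3 (MvPolynomial.X (Fin.last 3) ^ 4 * MvPolynomial.X (Fin.castSucc 2) ^ (2 * e) - MvPolynomial.rename Fin.castSucc (c * MvPolynomial.rename (Equiv.swap (0 : Fin 3) 1) c ^ 3 * ((MvPolynomial.X 0 - MvPolynomial.X 1) * ψ) ^ 2)) V → AlgebraicGeometry.Scheme.BirationalOver X.hom V.hom → Module.finrank ℚ (bettiCohomology X 1) = 0 ∧ ∀ τ j : X ⟶ X, (pull τ 2 ^ 4 = 1 ∧ pull j 2 ^ 2 = pull τ 2 ^ 2 ∧ pull j 2 * pull τ 2 = pull τ 2 ^ 3 * pull j 2 ∧ Module.finrank ℂ ↥(Module.End.eigenspace ((pull τ 2 ^ 2).baseChange ℂ) 1 ⊓ (hodge exists_isReal_hodgeModel_holds hX 2).piece 2 0) = 0 ∧ 0 <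 Module.finrank ℂ ↥(Module.End.eigenspace ((pull τ 2 ^ 2).baseChange ℂ) (-1) ⊓ (hodge exists_isReal_hodgeModel_holds hX 2).piece 2 0)) → Comm X hX τ j := by
  intro Uni Comm e he h6
  have h4 : 4 ≤ e := by omega
  have h₉ := Q8SymplecticPowersK1QOfStubsKollarFree.certifiedDeckFamilyQge6_of_member_kollarFree
    (Q8SymplecticPowersMemberDataOfCertificatesFactB.stub_memberDataQge6_of_jetStabilizer_clause hdel
      (Q8SymplecticPowersMemberCertificateOfKerDatum.stub_memberCertificateQge6_of_localConfiguration h₉₆)) he h6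
  exact K1Q_at_of_stubs_at @hcdk @hdel he h4 (h₁ he h6) h₉

/-- **Re-assembly**: the pointwise crux body for every even `e ≥ 4` is the registered crux `VeryGeneralQuaternionCommutatorsInHg` itself (by
`exact`), so the per-`e` theorems of this file are instances of the route decl and nothing else. [cite: CattaniDeligneKaplan1995, Thm. 1.1 and Cor. 1.2] -/
theorem VeryGeneralQuaternionCommutatorsInHg_of_pointwise
    (h : open Literature.AlgebraicGeometry.Motives Literature.AlgebraicGeometry.HodgeTheory Literature.AlgebraicGeometry.HodgeTheory.BettiUniverse Literature.AlgebraicGeometry.HodgeTheory.Q8Family Literature.AlgebraicGeometry.RelativeSpec Literature.AlgebraicGeometry.RelativeSpec.ActionOver Literature.Algebra.Lie Literature.Algebra.Lie.KatzRecognition CategoryTheory CategoryTheory.Limits MonoidalCategory CartesianMonoidalCategory AlgebraicGeometry in let Uni : (X : SchemeOver ℂ) → IsSmoothProjective 2 X → (X ⟶ X) → (X ⟶ X) → (bettiCohomology X 2 ≃ₗ[ℚ] bettiCohomology X 2) → Prop := fun X hX τ j g => (∀ x, g (pull τ 2 x) = pull τ 2 (g x)) ∧ (∀ x, g (pull j 2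 x) = pull j 2 (g x)) ∧ (∀ x y, tr hX (2 + 2) (cup X 2 2 (g x) (g y)) = tr hX (2 + 2) (cup X 2 2 x y)) ∧ ∀ x ∈ (hodge exists_isReal_hodgeModel_holds hX 2).hodgeClasses 1, g x = x; let Comm : (X : SchemeOver ℂ) → IsSmoothProjective 2 X → (X ⟶ X) → (X ⟶ X) → Prop := fun X hX τ j => haveI := finite hX 2; haveI : HodgeTensorFacts.{0, 0} := hodgeTensorFacts_holds; ∀ g h : bettiCohomology X 2 ≃ₗ[ℚ] bettiCohomology X 2, Uni X hX τ j g → Uni X hX τ j h → g * h * g⁻¹ * h⁻¹ ∈ (hodge exists_isReal_hodgeModel_holds hX 2).hodgeGroup; ∀ ⦃e : ℕ⦄, Even e → 4 ≤ e → ∃ G : ℕ → MvPolynomial ({d : Fin 3 →₀ ℕ // d.degree = 1} ⊕ {d : Fin 3 →₀ ℕ // d.degree = e - 1}) ℂ, (∀ i, ∃ c ψ : MvPolynomial (Fin 3) ℂ, c.IsHomogeneous 1 ∧ ψ.IsHomogeneous (e - 1) ∧ MvPolynomial.rename (Equiv.swap (0 : Fin 3) 1) ψ = ψ ∧ MvPolynomial.eval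 (Sum.elim (fun d => c.coeff d.1) (fun d => ψ.coeff d.1)) (G i) ≠ 0) ∧ ∀ c ψ : MvPolynomial (Fin 3) ℂ, c.IsHomogeneous 1 → ψ.IsHomogeneous (e - 1) → MvPolynomial.rename (Equiv.swap (0 : Fin 3) 1) ψ = ψ → (∀ i, MvPolynomial.eval (Sum.elim (fun d => c.coeff d.1) (fun d => ψ.coeff d.1)) (G i) ≠ 0) → ∀ ⦃V X : SchemeOver ℂ⦄ (hX : IsSmoothProjective 2 X), IsHypersurfaceCutOutBy 3 (MvPolynomial.X (Fin.last 3) ^ 4 * MvPolynomial.X (Fin.castSucc 2) ^ (2 * e) - MvPolynomial.rename Fin.castSucc (c * MvPolynomial.rename (Equiv.swap (0 : Fin 3) 1) c ^ 3 * ((MvPolynomial.X 0 - MvPolynomial.X 1) * ψ) ^ 2)) V → AlgebraicGeometry.Scheme.BirationalOver X.hom V.hom → Module.finrank ℚ (bettiCohomology X 1) = 0 ∧ ∀ τ j : X ⟶ X, (pull τ 2 ^ 4 = 1 ∧ pull j 2 ^ 2 = pull τ 2 ^ 2 ∧ pull j 2 * pull τ 2 = pull τ 2 ^ 3 * pull j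 2 ∧ Module.finrank ℂ ↥(Module.End.eigenspace ((pull τ 2 ^ 2).baseChange ℂ) 1 ⊓ (hodge exists_isReal_hodgeModel_holds hX 2).piece 2 0) = 0 ∧ 0 < Module.finrank ℂ ↥(Module.End.eigenspace ((pull τ 2 ^ 2).baseChange ℂ) (-1) ⊓ (hodge exists_isReal_hodgeModel_holds hX 2).piece 2 0)) → Comm X hX τ j) :
    VeryGeneralQuaternionCommutatorsInHg := h

/-- **The crux split by `e`**: S1 (registered, all `e`), LCERT₄, LCERT_{≥6}, CDK and Deligne 1987 give the crux BY NAME through the two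
pointwise cases (same inputs as `Q8SymplecticPowersK1QOfStubsKollarFree.VeryGeneralQuaternionCommutatorsInHg_of_stubs_kollarFree`, routed
through `K1Q_at_four_of_residues` ∕ `K1Q_at_ge6_of_residues`). [cite: CattaniDeligneKaplan1995, Thm. 1.1 and Cor. 1.2] [cite: Deligne1987, Prop. 1.13] -/
theorem VeryGeneralQuaternionCommutatorsInHg_of_cases
    (h₁ : open Literature.AlgebraicGeometry.Motives Literature.AlgebraicGeometry.HodgeTheory Literature.AlgebraicGeometry.HodgeTheory.BettiUniverse Literature.AlgebraicGeometry.HodgeTheory.Q8Family Literature.AlgebraicGeometry.RelativeSpec Literature.AlgebraicGeometry.RelativeSpec.ActionOver Literature.Algebra.Lie Literature.Algebra.Lie.KatzRecognition CategoryTheory CategoryTheory.Limits MonoidalCategory CartesianMonoidalCategory AlgebraicGeometry in ∀ ⦃e : ℕ⦄, Even e → 4 ≤ e → ∃ G : ℕ → MvPolynomial ({d : Fin 3 →₀ ℕ // d.degree = 1} ⊕ {d : Fin 3 →₀ ℕ // d.degree = e - 1}) ℂ, (∀ i, ∃ c ψ : MvPolynomial (Fin 3) ℂ, c.IsHomogeneous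 1 ∧ ψ.IsHomogeneous (e - 1) ∧ MvPolynomial.rename (Equiv.swap (0 : Fin 3) 1) ψ = ψ ∧ MvPolynomial.eval (Sum.elim (fun d => c.coeff d.1) (fun d => ψ.coeff d.1)) (G i) ≠ 0) ∧ ∀ c ψ : MvPolynomial (Fin 3) ℂ, c.IsHomogeneous 1 → ψ.IsHomogeneous (e - 1) → MvPolynomial.rename (Equiv.swap (0 : Fin 3) 1) ψ = ψ → (∀ i, MvPolynomial.eval (Sum.elim (fun d => c.coeff d.1) (fun d => ψ.coeff d.1)) (G i) ≠ 0) → ∀ ⦃V X : SchemeOver ℂ⦄ (hX : IsSmoothProjective 2 X), IsHypersurfaceCutOutBy 3 (MvPolynomial.X (Fin.last 3) ^ 4 * MvPolynomial.X (Fin.castSucc 2) ^ (2 * e) - MvPolynomial.rename Fin.castSucc (c * MvPolynomial.rename (Equiv.swap (0 : Fin 3) 1) c ^ 3 * ((MvPolynomial.X 0 - MvPolynomial.X 1) * ψ) ^ 2)) V → AlgebraicGeometry.Scheme.BirationalOver X.hom V.hom → Module.finrank ℚ (bettiCohomology X 1) = 0)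
    (h₉₄ : open Literature.AlgebraicGeometry.Motives Literature.AlgebraicGeometry.HodgeTheory Literature.AlgebraicGeometry.HodgeTheory.BettiUniverse Literature.AlgebraicGeometry.HodgeTheory.Q8Family Literature.AlgebraicGeometry.RelativeSpec Literature.AlgebraicGeometry.RelativeSpec.ActionOver CategoryTheory CategoryTheory.Limits MonoidalCategory CartesianMonoidalCategory AlgebraicGeometry Literature.AlgebraicTopology.SingularHomology in ∀ ⦃e : ℕ⦄, e = 4 → ∃ (W : (Spec (.of (ParamRing e))).Opens) (𝒳 : SchemeOver ℂ) (π : 𝒳 ⟶ base W) (τ j : 𝒳 ⟶ 𝒳) (ι : (deckChart (fun i => (MvPolynomial.X i : ParamRing e)) ⊗ Over.mk W.ι).left ⟶ 𝒳.left), ∃ (_ : Nonempty (ComplexPoints (base W))) (hπ : IsSmoothProjectiveFamily π 2) (_ : IsQuasiProjectiveOver 𝒳) (_ : IsQuasiProjectiveOver (base W)) (_ : AlgebraicGeometry.SmoothOfRelativeDimension (Fintype.card (CIdx e)) (base W).hom) (hτπ : τ ≫ π = π) (hjπ : j ≫ π = π) (_ : τ ≫ τ ≫ τ ≫ τ = 𝟙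 𝒳) (_ : j ≫ j = τ ≫ τ) (_ : τ ≫ j ≫ τ = j) (_ : IsOpenImmersion ι) (_ : ι ≫ π.left = (snd (deckChart (fun i => (MvPolynomial.X i : ParamRing e))) (Over.mk W.ι)).left) (_ : ((Over.isoMk ((deckAction (fun i => (MvPolynomial.X i : ParamRing e))).aut (QuaternionGroup.a 1)) ((deckAction (fun i => (MvPolynomial.X i : ParamRing e))).aut_comp (QuaternionGroup.a 1))).hom ▷ Over.mk W.ι).left ≫ ι = ι ≫ τ.left) (_ : ((Over.isoMk ((deckAction (fun i => (MvPolynomial.X i : ParamRing e))).aut (QuaternionGroup.xa 0)) ((deckAction (fun i => (MvPolynomial.X i : ParamRing e))).aut_comp (QuaternionGroup.xa 0))).hom ▷ Over.mk W.ι).left ≫ ι = ι ≫ j.left) (_ : Function.Surjective (snd (deckChart (fun i => (MvPolynomial.X i : ParamRing e))) (Over.mk W.ι)).left), ∀ (hU : IsCohomologicallyLocallyTrivialOn π Set.univ), ∃ (b : ComplexPoints (base W)) (ψ : OpenPartialHomeomorph (Set.univ : Set (ComplexPoints (base W))) (Fin (Fintype.card (CIdx e)) → ℂ)) (W₀ :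 Set (Set.univ : Set (ComplexPoints (base W)))) (ω : (Fin (Fintype.card (CIdx e)) → ℂ) → TensorProduct ℚ ℂ (bettiCohomology (fiberOver π b) 2)) (r : ℕ), IsOpen W₀ ∧ (⟨b, Set.mem_univ b⟩ : (Set.univ : Set (ComplexPoints (base W)))) ∈ W₀ ∧ W₀ ⊆ ψ.source ∧ (let Xb := fiberOver π b; let hXb : IsSmoothProjective 2 Xb := hπ.isSmoothProjective b; let Ab : bettiCohomology Xb 2 →ₗ[ℚ] bettiCohomology Xb 2 := pull (fiberOverEnd π τ hτπ b) 2; let Mb : Submodule ℂ (TensorProduct ℚ ℂ (bettiCohomology Xb 2)) := Module.End.eigenspace (Ab.baseChange ℂ) Complex.I; Module.finrank ℂ ↥(Module.End.eigenspace ((Ab ^ 2).baseChange ℂ) 1 ⊓ (hodge exists_isReal_hodgeModel_holds hXb 2).piece 2 0) = 0 ∧ 0 < Module.finrank ℂ ↥(Module.End.eigenspace ((Ab ^ 2).baseChange ℂ) (-1) ⊓ (hodge exists_isReal_hodgeModel_holds hXb 2).piece 2 0) ∧ 6 ≤ Module.finrank ℂ ↥Mb ∧ Module.finrank ℂ ↥(Mb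 ⊓ (hodge exists_isReal_hodgeModel_holds hXb 2).F 2) ≤ 1 ∧ (∀ t ∈ W₀, ∀ (ε : Path (⟨b, Set.mem_univ b⟩ : (Set.univ : Set (ComplexPoints (base W)))) t), (∀ r', ε r' ∈ W₀) → ∀ (T : bettiCohomology Xb 2 ≃ₗ[ℚ] bettiCohomology (fiberOver π t.1) 2), (∀ v, ofRatClass _ 2 (T v) = transportFun π 2 hU ⟦ε⟧ (ofRatClass _ 2 v)) → ω (ψ t) ∈ Mb ⊓ ((hodge exists_isReal_hodgeModel_holds (hπ.isSmoothProjective t.1) 2).comapEquiv T).F 2) ∧ (∀ φ : Module.Dual ℂ (TensorProduct ℚ ℂ (bettiCohomology Xb 2)), (∀ i ≤ r, iteratedFDeriv ℂ i (fun z ↦ φ (ω z)) (ψ ⟨b, Set.mem_univ b⟩) = 0) → ∀ m ∈ Mb, φ m = 0)) ∧ ∃ (γ : bettiCohomology (fiberOver π b) 2 ≃ₗ[ℚ] bettiCohomology (fiberOver π b) 2), γ ∈ ratMonodromyGroup π 2 hU ⟨b, Set.mem_univ b⟩ ∧ (∃ a, pull (fiberOverEnd π τ hτπ b) 2 (pull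 (fiberOverEnd π τ hτπ b) 2 a) = -a ∧ γ a ≠ a) ∧ ∃ (h : ComplexPoints (fiberOver π b) ≃ₜ ComplexPoints (fiberOver π b)), (∀ a, γ a = (singularCohomology.map ℚ ℚ (h : C(ComplexPoints (fiberOver π b), ComplexPoints (fiberOver π b))) 2).hom a) ∧ singularHomology.map ℚ ℚ (h : C(ComplexPoints (fiberOver π b), ComplexPoints (fiberOver π b))) 4 (complexOrientationRat (hπ.isSmoothProjective b)).fundamentalClass = (complexOrientationRat (hπ.isSmoothProjective b)).fundamentalClass ∧ (∀ x, h ((AlgPoints.mapContinuous (L := ℂ) (fiberOverEnd π τ hτπ b)) x) = (AlgPoints.mapContinuous (L := ℂ) (fiberOverEnd π τ hτπ b)) (h x)) ∧ ∃ (A₁ A₂ B : Set (ComplexPoints (fiberOver π b))), IsOpen A₁ ∧ IsOpen A₂ ∧ IsOpen B ∧ A₁ ∪ A₂ ∪ B = Set.univ ∧ Disjoint (closure A₁) A₂ ∧ (∀ x ∈ B, h x = x) ∧ ∃ (hhA₁ : Set.MapsTo (h : C(ComplexPoints (fiberOver π b), ComplexPoints (fiberOver π b))) A₁ A₁) (hhA₂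 : Set.MapsTo (h : C(ComplexPoints (fiberOver π b), ComplexPoints (fiberOver π b))) A₂ A₂) (hτA₁ : Set.MapsTo (AlgPoints.mapContinuous (L := ℂ) (fiberOverEnd π τ hτπ b)) A₁ A₁) (hτA₂ : Set.MapsTo (AlgPoints.mapContinuous (L := ℂ) (fiberOverEnd π τ hτπ b)) A₂ A₂) (_ : Set.MapsTo (AlgPoints.mapContinuous (L := ℂ) (fiberOverEnd π j hjπ b)) A₁ A₂) (_ : Set.MapsTo (AlgPoints.mapContinuous (L := ℂ) (fiberOverEnd π j hjπ b)) A₂ A₁) (_ : Module.Finite ℚ (singularHomology ℚ ℚ (↥A₁) 2)) (_ : Module.Finite ℚ (singularHomology ℚ ℚ (↥A₂) 2)), Module.finrank ℚ ↥(Module.End.eigenspace ((singularHomology.map ℚ ℚ (singularHomology.restrictSelf (AlgPoints.mapContinuous (L := ℂ) (fiberOverEnd π τ hτπ b)) hτA₁) 2).hom ^ 2) (-1 : ℚ)) ≤ 2 ∧ (∀ a : singularHomology ℚ ℚ (↥A₁) 2, singularHomology.map ℚ ℚ (singularHomology.restrictSelf (AlgPoints.mapContinuous (L := ℂ) (fiberOverEnd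 π τ hτπ b)) hτA₁) 2 (singularHomology.map ℚ ℚ (singularHomology.restrictSelf (AlgPoints.mapContinuous (L := ℂ) (fiberOverEnd π τ hτπ b)) hτA₁) 2 a) = -a → singularHomology.map ℚ ℚ (singularHomology.restrictSelf (h : C(ComplexPoints (fiberOver π b), ComplexPoints (fiberOver π b))) hhA₁) 2 a = singularHomology.map ℚ ℚ (singularHomology.restrictSelf (AlgPoints.mapContinuous (L := ℂ) (fiberOverEnd π τ hτπ b)) hτA₁) 2 a) ∧ (∀ a : singularHomology ℚ ℚ (↥A₂) 2, singularHomology.map ℚ ℚ (singularHomology.restrictSelf (AlgPoints.mapContinuous (L := ℂ) (fiberOverEnd π τ hτπ b)) hτA₂) 2 (singularHomology.map ℚ ℚ (singularHomology.restrictSelf (AlgPoints.mapContinuous (L := ℂ) (fiberOverEnd π τ hτπ b)) hτA₂) 2 a) = -a → singularHomology.map ℚ ℚ (singularHomology.restrictSelf (h : C(ComplexPoints (fiberOver π b), ComplexPoints (fiberOver π b))) hhA₂) 2 (singularHomology.map ℚ ℚ (singularHomology.restrictSelf (AlgPoints.mapContinuous (L := ℂ) (fiberOverEnd π τ hτπ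 b)) hτA₂) 2 a) = a))
    (h₉₆ : open Literature.AlgebraicGeometry.Motives Literature.AlgebraicGeometry.HodgeTheory Literature.AlgebraicGeometry.HodgeTheory.BettiUniverse Literature.AlgebraicGeometry.HodgeTheory.Q8Family Literature.AlgebraicGeometry.RelativeSpec Literature.AlgebraicGeometry.RelativeSpec.ActionOver CategoryTheory CategoryTheory.Limits MonoidalCategory CartesianMonoidalCategory AlgebraicGeometry Literature.AlgebraicTopology.SingularHomology in ∀ ⦃e : ℕ⦄, Even e → 6 ≤ e → ∃ (W : (Spec (.of (ParamRing e))).Opens) (𝒳 : SchemeOver ℂ) (π : 𝒳 ⟶ base W) (τ j : 𝒳 ⟶ 𝒳) (ι : (deckChart (fun i => (MvPolynomial.X i : ParamRing e)) ⊗ Over.mk W.ι).left ⟶ 𝒳.left), ∃ (_ : Nonempty (ComplexPoints (base W))) (hπ : IsSmoothProjectiveFamily π 2) (_ : IsQuasiProjectiveOver 𝒳) (_ : IsQuasiProjectiveOver (base W)) (_ : AlgebraicGeometry.SmoothOfRelativeDimension (Fintype.card (CIdx e)) (base W).hom) (hτπ : τ ≫ π = π) (hjπ : j ≫ π = π) (_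 : τ ≫ τ ≫ τ ≫ τ = 𝟙 𝒳) (_ : j ≫ j = τ ≫ τ) (_ : τ ≫ j ≫ τ = j) (_ : IsOpenImmersion ι) (_ : ι ≫ π.left = (snd (deckChart (fun i => (MvPolynomial.X i : ParamRing e))) (Over.mk W.ι)).left) (_ : ((Over.isoMk ((deckAction (fun i => (MvPolynomial.X i : ParamRing e))).aut (QuaternionGroup.a 1)) ((deckAction (fun i => (MvPolynomial.X i : ParamRing e))).aut_comp (QuaternionGroup.a 1))).hom ▷ Over.mk W.ι).left ≫ ι = ι ≫ τ.left) (_ : ((Over.isoMk ((deckAction (fun i => (MvPolynomial.X i : ParamRing e))).aut (QuaternionGroup.xa 0)) ((deckAction (fun i => (MvPolynomial.X i : ParamRing e))).aut_comp (QuaternionGroup.xa 0))).hom ▷ Over.mk W.ι).left ≫ ι = ι ≫ j.left) (_ : Function.Surjective (snd (deckChart (fun i => (MvPolynomial.X i : ParamRing e))) (Over.mk W.ι)).left), ∀ (hU : IsCohomologicallyLocallyTrivialOn π Set.univ), ∃ (b : ComplexPoints (base W)) (ψ : OpenPartialHomeomorph (Set.univ : Set (ComplexPoints (base W))) (Fin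 (Fintype.card (CIdx e)) → ℂ)) (W₀ : Set (Set.univ : Set (ComplexPoints (base W)))) (ι₁ ι₂ : Type) (ω : (Fin (Fintype.card (CIdx e)) → ℂ) → ι₁ → TensorProduct ℚ ℂ (bettiCohomology (fiberOver π b) 2)) (η : (Fin (Fintype.card (CIdx e)) → ℂ) → ι₂ → Module.Dual ℂ (TensorProduct ℚ ℂ (bettiCohomology (fiberOver π b) 2))) (r : ℕ), IsOpen W₀ ∧ (⟨b, Set.mem_univ b⟩ : (Set.univ : Set (ComplexPoints (base W)))) ∈ W₀ ∧ W₀ ⊆ ψ.source ∧ (let Xb := fiberOver π b; let hXb : IsSmoothProjective 2 Xb := hπ.isSmoothProjective b; let Ab : bettiCohomology Xb 2 →ₗ[ℚ] bettiCohomology Xb 2 := pull (fiberOverEnd π τ hτπ b) 2; let Mb : Submodule ℂ (TensorProduct ℚ ℂ (bettiCohomology Xb 2)) := Module.End.eigenspace (Ab.baseChange ℂ) Complex.I; Module.finrank ℂ ↥(Module.End.eigenspace ((Ab ^ 2).baseChange ℂ) 1 ⊓ (hodge exists_isReal_hodgeModel_holds hXb 2).piece 2 0) = 0 ∧ 0 <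 Module.finrank ℂ ↥(Module.End.eigenspace ((Ab ^ 2).baseChange ℂ) (-1) ⊓ (hodge exists_isReal_hodgeModel_holds hXb 2).piece 2 0) ∧ 6 ≤ Module.finrank ℂ ↥Mb ∧ (∀ t ∈ W₀, ∀ (ε : Path (⟨b, Set.mem_univ b⟩ : (Set.univ : Set (ComplexPoints (base W)))) t), (∀ r', ε r' ∈ W₀) → ∀ (T : bettiCohomology Xb 2 ≃ₗ[ℚ] bettiCohomology (fiberOver π t.1) 2), (∀ v, ofRatClass _ 2 (T v) = transportFun π 2 hU ⟦ε⟧ (ofRatClass _ 2 v)) → ∀ i, ω (ψ t) i ∈ Mb ⊓ ((hodge exists_isReal_hodgeModel_holds (hπ.isSmoothProjective t.1) 2).comapEquiv T).F 2) ∧ (∀ t ∈ W₀, ∀ (ε : Path (⟨b, Set.mem_univ b⟩ : (Set.univ : Set (ComplexPoints (base W)))) t), (∀ r', ε r' ∈ W₀) → ∀ (T : bettiCohomology Xb 2 ≃ₗ[ℚ] bettiCohomology (fiberOver π t.1) 2), (∀ v, ofRatClass _ 2 (T v) = transportFun π 2 hU ⟦ε⟧ (ofRatClass _ 2 v)) →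 ∀ l, ∀ x ∈ Mb ⊓ ((hodge exists_isReal_hodgeModel_holds (hπ.isSmoothProjective t.1) 2).comapEquiv T).F 2, η (ψ t) l x = 0) ∧ (∀ φ : (TensorProduct ℚ ℂ (bettiCohomology Xb 2)) →ₗ[ℂ] (TensorProduct ℚ ℂ (bettiCohomology Xb 2)), (∀ x ∈ Mb, φ x ∈ Mb) → (∀ i l, ∀ m ≤ r, iteratedFDeriv ℂ m (fun z ↦ η z l (φ (ω z i))) (ψ ⟨b, Set.mem_univ b⟩) = 0) → ∃ c : ℂ, ∀ x ∈ Mb, φ x = c • x)) ∧ ∃ (γ : bettiCohomology (fiberOver π b) 2 ≃ₗ[ℚ] bettiCohomology (fiberOver π b) 2), γ ∈ ratMonodromyGroup π 2 hU ⟨b, Set.mem_univ b⟩ ∧ (∃ a, pull (fiberOverEnd π τ hτπ b) 2 (pull (fiberOverEnd π τ hτπ b) 2 a) = -a ∧ γ a ≠ a) ∧ ∃ (h : ComplexPoints (fiberOver π b) ≃ₜ ComplexPoints (fiberOver π b)), (∀ a, γ a = (singularCohomology.map ℚ ℚ (h : C(ComplexPoints (fiberOver π b), ComplexPoints (fiberOver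 π b))) 2).hom a) ∧ singularHomology.map ℚ ℚ (h : C(ComplexPoints (fiberOver π b), ComplexPoints (fiberOver π b))) 4 (complexOrientationRat (hπ.isSmoothProjective b)).fundamentalClass = (complexOrientationRat (hπ.isSmoothProjective b)).fundamentalClass ∧ (∀ x, h ((AlgPoints.mapContinuous (L := ℂ) (fiberOverEnd π τ hτπ b)) x) = (AlgPoints.mapContinuous (L := ℂ) (fiberOverEnd π τ hτπ b)) (h x)) ∧ ∃ (A₁ A₂ B : Set (ComplexPoints (fiberOver π b))), IsOpen A₁ ∧ IsOpen A₂ ∧ IsOpen B ∧ A₁ ∪ A₂ ∪ B = Set.univ ∧ Disjoint (closure A₁) A₂ ∧ (∀ x ∈ B, h x = x) ∧ ∃ (hhA₁ : Set.MapsTo (h : C(ComplexPoints (fiberOver π b), ComplexPoints (fiberOver π b))) A₁ A₁) (hhA₂ : Set.MapsTo (h : C(ComplexPoints (fiberOver π b), ComplexPoints (fiberOver π b))) A₂ A₂) (hτA₁ : Set.MapsTo (AlgPoints.mapContinuous (L := ℂ) (fiberOverEnd π τ hτπ b)) A₁ A₁) (hτA₂ : Set.MapsTo (AlgPoints.mapContinuous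 (L := ℂ) (fiberOverEnd π τ hτπ b)) A₂ A₂) (_ : Set.MapsTo (AlgPoints.mapContinuous (L := ℂ) (fiberOverEnd π j hjπ b)) A₁ A₂) (_ : Set.MapsTo (AlgPoints.mapContinuous (L := ℂ) (fiberOverEnd π j hjπ b)) A₂ A₁) (_ : Module.Finite ℚ (singularHomology ℚ ℚ (↥A₁) 2)) (_ : Module.Finite ℚ (singularHomology ℚ ℚ (↥A₂) 2)), Module.finrank ℚ ↥(Module.End.eigenspace ((singularHomology.map ℚ ℚ (singularHomology.restrictSelf (AlgPoints.mapContinuous (L := ℂ) (fiberOverEnd π τ hτπ b)) hτA₁) 2).hom ^ 2) (-1 : ℚ)) ≤ 2 ∧ (∀ a : singularHomology ℚ ℚ (↥A₁) 2, singularHomology.map ℚ ℚ (singularHomology.restrictSelf (AlgPoints.mapContinuous (L := ℂ) (fiberOverEnd π τ hτπ b)) hτA₁) 2 (singularHomology.map ℚ ℚ (singularHomology.restrictSelf (AlgPoints.mapContinuous (L := ℂ) (fiberOverEnd π τ hτπ b)) hτA₁) 2 a) = -a → singularHomology.map ℚ ℚ (singularHomology.restrictSelf (h : C(ComplexPoints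 (fiberOver π b), ComplexPoints (fiberOver π b))) hhA₁) 2 a = singularHomology.map ℚ ℚ (singularHomology.restrictSelf (AlgPoints.mapContinuous (L := ℂ) (fiberOverEnd π τ hτπ b)) hτA₁) 2 a) ∧ (∀ a : singularHomology ℚ ℚ (↥A₂) 2, singularHomology.map ℚ ℚ (singularHomology.restrictSelf (AlgPoints.mapContinuous (L := ℂ) (fiberOverEnd π τ hτπ b)) hτA₂) 2 (singularHomology.map ℚ ℚ (singularHomology.restrictSelf (AlgPoints.mapContinuous (L := ℂ) (fiberOverEnd π τ hτπ b)) hτA₂) 2 a) = -a → singularHomology.map ℚ ℚ (singularHomology.restrictSelf (h : C(ComplexPoints (fiberOver π b), ComplexPoints (fiberOver π b))) hhA₂) 2 (singularHomology.map ℚ ℚ (singularHomology.restrictSelf (AlgPoints.mapContinuous (L := ℂ) (fiberOverEnd π τ hτπ b)) hτA₂) 2 a) = a))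
    (hcdk : open Literature.AlgebraicGeometry.HodgeTheory in cmsp_nonHodgeGenericPoints_countable_algebraic_cover)
    (hdel : Literature.AlgebraicGeometry.HodgeTheory.deligne1987_monodromy_directSum_irreducible_subvariations) :
    VeryGeneralQuaternionCommutatorsInHg := by
  refine VeryGeneralQuaternionCommutatorsInHg_of_pointwise ?_
  intro Uni Comm e he h4
  by_cases he4 : e = 4
  · exact K1Q_at_four_of_residues (fun e' he4' => h₁ ⟨2, by omega⟩ (by omega)) h₉₄ @hcdk @hdel he4
  · exact K1Q_at_ge6_of_residues (fun e' he' h6' => h₁ he' (by omega)) h₉₆ @hcdk @hdel he (by rcases he with ⟨r, hr⟩; omega)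

end Summit.HodgeConjecture.HodgeConjecture.Theorems.Q8SymplecticPowersK1QPointwise
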